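import Literature.Barriers.ABC.BakerMethodBoundsKummerArchProofs
import Mathlib.RingTheory.Polynomial.Cyclotomic.Roots
import Mathlib.RingTheory.Norm.Defs
import Mathlib.FieldTheory.KummerPolynomial
import Mathlib.FieldTheory.KummerExtension
import Mathlib.Algebra.Module.Rat
import HarnessLib

/-!
# Proofs for `BakerMethodBounds`, VIII: Stewart–Yu 1991, Lemma 3 — the Kummer conditions over
# `ℚ(ζ₄)` and `ℚ(ζ₆)`

`Literature/Barriers/ABC/BakerMethodBoundsStewartYu1991KummerProofs.lean` — proofs companion of
the barrier file `Literature/Barriers/ABC/BakerMethodBounds.lean` (theorems only: no definition,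
no named fact), serving the named fact `Literature.Barriers.ABC.stewartYu1991_upperBound`
(`log c ≤ κ(ε) R^{2/3+ε}`), whose printed proof line is formalised in
`BakerMethodBoundsStewartYu1991LineProofs.lean` modulo Lemma 1 (= Yu 1990, Cor. 2.3, applied in
`K = ℚ(ζ₄)` for `p > 2` and in `K = ℚ(ζ₆)` for `p = 2`). Yu's Corollary 2.3 carries the Kummer
condition (2.15) `[K(α₀^{1/q}, α₁^{1/q}, …, αₙ^{1/q}) : K] = q^{n+1}`; Stewart–Yu verify it for their
generators in

**Lemma 3** (Math. Ann. 291 (1991), p. 227, read on the GDZ scan `PPN235181684_0291`). *Let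
`α₁ < ⋯ < αₙ` be prime numbers. Then `[ℚ(α₁^{1/2}, …, αₙ^{1/2}) : ℚ] = 2ⁿ`. Let `q = 2` and
`α₀ = ζ₄` or `q = 3` and `α₀ = ζ₆` and put `K = ℚ(α₀)`. Then
`[K(α₀^{1/q}, α₁^{1/q}, …, αₙ^{1/q}) : K] = q^{n+1}` except when `q = 2`, `α₀ = ζ₄`, and `α₁ = 2`
and in this case `[K(α₀^{1/2}, (1 + i)^{1/2}, α₂^{1/2}, …, αₙ^{1/2}) : K] = 2^{n+1}`.* The printed
proof treats `q = 2`, `α₀ = i`, `α₁ = 2` by the Kummer lemma of Baker–Stark (their [1], Lemma 3):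
if `[K_j(α_j^{1/2}) : K_j] < 2` then `α_j = α₀^{k₀} ⋯ α_{j-1}^{k_{j-1}} γ²` with `γ ∈ K`, and a prime
ideal `℘ ∣ α_j` of `ℚ(i)` (`α_j` odd, unramified, or `℘ = (1 + i)`) has `ord_℘ α_j = 1 = 2 ord_℘ γ`,
contradiction; "the other cases are proved in a similar fashion". In §3 (p. 228) it is applied with
`2⁴ = (1 + i)⁸`.

**What this file proves** (the first display, over `ℚ`, is `finrank_adjoin_sqrt_eq_two_pow` of
`BakerMethodBoundsKummerArchProofs.lean`; the case `K = ℚ`, `α₀ = -1` is its §KummerNegOne):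

* §Multiquadratic (base `K`): `Multiquadratic.finrank_adjoin_eq_two_pow_of_mul_self_eq_base`, the
  `Fin`-indexed form over an arbitrary base field of the tree's Baker–Stark descent engine
  `Multiquadratic.finrank_adjoin_image_sqrt_and_sq`.
* §ZetaFour: `K` any field with `[K : ℚ] = 2` and `ι ∈ K`, `ι² = -1` (i.e. `K ≅ ℚ(ζ₄)`; for the
  model `ℚ⟮ι⟯ ⊂ L` see the `_model` corollaries): coordinates `a + bι` (private plumbing)
  and the four square-class lemmas — `r`, `ι r`, `(1 + ι) r`, `ι (1 + ι) r` (`r ∈ ℚ`) are squares in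
  `K` only when `r` resp. `2r` is a rational square, resp. `r = 0` — replacing the prime-ideal
  argument of the paper by the equivalent computation with `(a + bι)² = (a² − b²) + 2abι`.
* §LemmaThreeZetaFour: `not_isSquare_prod_zeta4_oddPrimes`,
  `not_isSquare_prod_zeta4_onePlusZeta4_oddPrimes` (independence of the square classes of
  `ι, p₁, …, pₙ` resp. `ι, 1 + ι, p₁, …, pₙ` for distinct odd primes — the form the descent
  consumes) and **Lemma 3 for `q = 2`**: `finrank_adjoin_sqrt_zeta4_oddPrimes`
  (`[K(ι^{1/2}, p₁^{1/2}, …, pₙ^{1/2}) : K] = 2^{n+1}`) and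
  `finrank_adjoin_sqrt_zeta4_onePlusZeta4_oddPrimes`
  (`[K(ι^{1/2}, (1+ι)^{1/2}, p₁^{1/2}, …, pₙ^{1/2}) : K] = 2^{n+2}`, `n` odd primes), for square roots
  taken in ANY field `L ⊇ K` (e.g. `ℂ` or `ℂ_p`); `one_add_iota_pow_eight` is `(1 + ι)⁸ = 2⁴`;
  `…_model`: the same for `K = ℚ⟮ι⟯ ⊂ L`, `L ⊇ ℚ` any field containing `ι` (no hypothesis on `K`).
* §Multicubic (base `K`, `char ≠ 3`): the cube-root analogue of the engine — a pure cubic step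
  `K(y)/K`, `y³ = c` not a cube, has degree `3` (Mathlib `X_pow_sub_C_irreducible_iff_of_prime`)
  and `Multicubic.cube_descent`: an `x ∈ F` which is a cube in `F(y)` is `(y³)ᵏ γ³`, `γ ∈ F` (by
  comparing coefficients of `(u + vy + wy²)³`; no cube root of unity is needed); induction gives
  `Multicubic.finrank_adjoin_eq_three_pow_of_cube_eq` (`[K(y₀, …, y_{n-1}) : K] = 3ⁿ` when no
  monomial `∏ cᵢ^{kᵢ}` with some `3 ∤ kᵢ` is a cube in `K`).
* §ZetaSix: `K` any field with `[K : ℚ] = 2` and `ζ ∈ K`, `ζ² − ζ + 1 = 0` (`K ≅ ℚ(ζ₆)`): the norm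
  `N_{K/ℚ}` (Mathlib `Algebra.norm`) has `N(ζ) = ±1`, `N(r) = r²`; `ZetaSix.cyclotomic_nine_no_root`
  (`Φ₉` has no root in `K`, degree `6 > 2`), `ZetaSix.three_dvd_of_zeta_pow_eq_cube`, and the
  cube-class independence `ZetaSix.not_cube_prod_zeta6_primes` of `ζ, p₁, …, pₙ` (distinct primes).
* §LemmaThreeZetaSix: **Lemma 3 for `q = 3`**: `finrank_adjoin_cbrt_zeta6_primes`
  (`[K(ζ^{1/3}, p₁^{1/3}, …, pₙ^{1/3}) : K] = 3^{n+1}`), cube roots in any `L ⊇ K`, and its `_model`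
  form for `K = ℚ⟮ζ⟯ ⊂ L`.
* §MonomialBases (appended): the Kummer condition in the form the `q`-descent USES — the `qⁿ`
  monomials `∏ yⱼ^{λⱼ}`, `0 ≤ λⱼ < q`, are linearly independent over the base field
  [cite: Yu1990, (2.110) (p. 59)]: `Multiquadratic.linearIndependent_prod_of_mul_self_eq_base`
  (`q = 2`, base `K`, roots in any `L`; the tree's `linearIndependent_prod_sqrt` is the case
  `K = ℚ`, `L = ℝ`) and `Multicubic.linearIndependent_prod_pow_of_cube_eq` (`q = 3`).
* §CubeClassesRat (appended): the `q = 3` case over `ℚ` — `not_cube_prod_pow_primes_rat`,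
  `not_cube_prod_pow_primes_sq_rat` (no monomial in distinct primes, resp. their squares, with an
  exponent `≢ 0 (mod 3)` is a rational cube), `finrank_adjoin_cbrt_primes_rat`,
  `finrank_adjoin_cbrt_primes_sq_rat` (`[ℚ(∛p₁, …, ∛pₙ) : ℚ] = 3ⁿ`, also for `∛(pⱼ²)`; any `L ⊇ ℚ`)
  and `linearIndependent_prod_pow_cbrt_primes_sq_rat` (the `3ⁿ` monomials in the `∛(pⱼ²)`) — the
  Kummer inputs of a `2`-adic `q = 3` descent over `K = ℚ` with generators `qⱼ² ≡ 1 (mod 8)`.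
* §LemmaOneEight (appended): Yu 1990 Lemma 1.8 — `yu1990_lemma_1_8`: for a prime `r`, a field `E`
  (with `-1 ∈ E²` when `r = 2`) and `a ∉ Eʳ`, `x^{r^k} − a` is irreducible over `E`; the `r = 2`
  case `X_pow_two_pow_sub_C_irreducible` is new (Mathlib's `X_pow_sub_C_irreducible_of_prime_pow`
  covers odd `r`), proved by the norm argument down the tower `E(a^{1/2^k})/E`.
* §NormForm (appended): the algebra of the THIRD-POINT Liouville estimate of a `q = 3` descent —
  `Multicubic.cubicNorm_eq_mul_cofactor` (`N(u + v y + w y²) = u³ + c v³ + c² w³ − 3c u v w` with an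
  explicit cofactor, `y³ = c`, any commutative ring), `Multicubic.cubicNorm_ne_zero` (`N ≠ 0` when
  `c` is not a cube in `F ∋ u, v, w` and `(u, v, w) ≠ 0`; no root of unity, any characteristic),
  `Multicubic.not_cube_mem_adjoin_init_of_cube_eq` / `cubicNorm_ne_zero_of_cube_eq` (the top
  generator is not a cube below it, under the cube-Kummer hypothesis), and the `ℚ`-specialisations
  `not_cube_mem_adjoin_init_cbrt_primes_sq_rat`, `cubicNorm_ne_zero_cbrt_primes_sq_rat` for the
  generators `pⱼ²` of the `2`-adic descent.

Design. `K` is abstract (`[K : ℚ] = 2` plus a distinguished root of `X² + 1` resp. `X² − X + 1`),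
so the lemmas apply verbatim to `ℚ(i) ⊂ ℂ`, to `ℚ(i)` realised inside `ℚ_p` (`p ≡ 1 mod 4`) or
`ℂ_p`, and to any abstract model; the roots `yⱼ` live in an arbitrary extension `L` of `K`. No new
definition, no named fact; zero change to the trust base.

## References

* [StewartYu1991] C. L. Stewart, Kunrui Yu, *On the abc conjecture*, Math. Ann. 291 (1991),
  225–230 — Lemma 3 (p. 227) and its use in §3 (p. 228).
* [Yu1990] Kunrui Yu, *Linear forms in p-adic logarithms II*, Compositio Math. 74 (1990), 15–113 —
  hypothesis (2.15) of Theorem 2.1 / Corollary 2.3 (p. 31–32); Lemma 1.9 (p. 28, Baker–Stark).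
* [Karpilovsky1988] G. Karpilovsky, *Unit groups of classical rings*, Oxford University Press
  (1988) — §2.5 "Units in pure cubic fields", proof of Lemma 2.5.2, formula (12) (p. 63):
  `N(x + y∛(ab²) + z∛(a²b)) = x³ + ab²y³ + a²bz³ − 3abxyz`.
-/

noncomputable section

open Finset Polynomial IntermediateField Module

namespace Literature.Barriers.ABC

/-! ### The engine over an arbitrary base field, `Fin`-indexed -/

namespace Multiquadratic

variable {K L : Type*} [Field K] [Field L] [Algebra K L]

/-- **Multiquadratic Kummer condition over a base field `K`** (`char ≠ 2`), `Fin`-indexed form of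
`finrank_adjoin_image_sqrt_and_sq`: if `y₀, …, y_{n-1} ∈ L` satisfy `yⱼ² = αⱼ ∈ K` and no product
of a non-empty subfamily of the `αⱼ` is a square in `K`, then `[K(y₀, …, y_{n-1}) : K] = 2ⁿ`
(the `n`-fold iteration of the Baker–Stark Kummer lemma as quoted by Yu, for `p = 2`).
[cite: Yu1990, Lemma 1.9 (p. 28), iterated (= Baker–Stark 1971, Lemma 3)] -/
theorem finrank_adjoin_eq_two_pow_of_mul_self_eq_base (h2 : (2 : L) ≠ 0) {n : ℕ}
    (α : Fin n → K) (y : Fin n → L) (hy : ∀ j, y j * y j = algebraMap K L (α j))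
    (hind : ∀ T : Finset (Fin n), T.Nonempty → ¬ IsSquare (∏ j ∈ T, α j)) :
    Module.finrank K ↥(IntermediateField.adjoin K (Set.range y)) = 2 ^ n := by
  classical
  set c : ℕ → K := fun i => if h : i < n then α ⟨i, h⟩ else 0 with hc
  set y' : ℕ → L := fun i => if h : i < n then y ⟨i, h⟩ else 0 with hy'
  have hyc : ∀ i, algebraMap K L (c i) = y' i * y' i := by
    intro i
    by_cases h : i < n
    · simp only [hc, hy', dif_pos h]; exact (hy _).symm
    · simp only [hc, hy', dif_neg h, map_zero, mul_zero]
  have hrange : Set.range y = y' '' {i | i < n} := by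
    ext z
    simp only [Set.mem_range, Set.mem_image, Set.mem_setOf_eq]
    constructor
    · rintro ⟨j, rfl⟩
      exact ⟨j, j.2, by simp [hy', j.2]⟩
    · rintro ⟨i, hi, rfl⟩
      exact ⟨⟨i, hi⟩, by simp [hy', hi]⟩
  have hind' : ∀ T : Finset ℕ, (∀ i ∈ T, i < n) → T.Nonempty → ¬ IsSquare (∏ i ∈ T, c i) := by
    intro T hT hTne hsq
    set T' : Finset (Fin n) := Finset.univ.filter fun j => (j : ℕ) ∈ T with hT'
    have hmap : T'.map Fin.valEmbedding = T := by
      ext i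
      simp only [Finset.mem_map, Finset.mem_filter, Finset.mem_univ, true_and,
        Fin.valEmbedding_apply, hT']
      constructor
      · rintro ⟨j, hj, rfl⟩; exact hj
      · intro hi; exact ⟨⟨i, hT i hi⟩, hi, rfl⟩
    have hprod : ∏ i ∈ T, c i = ∏ j ∈ T', α j := by
      rw [← hmap, Finset.prod_map]
      refine Finset.prod_congr rfl fun j _ => ?_
      simp [hc, j.2]
    have hT'ne : T'.Nonempty := by
      obtain ⟨i, hi⟩ := hTne
      exact ⟨⟨i, hT i hi⟩, by simp [hT', hi]⟩
    exact hind T' hT'ne (hprod ▸ hsq)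
  rw [hrange]
  exact (finrank_adjoin_image_sqrt_and_sq h2 y' c hyc n hind' n le_rfl).1

end Multiquadratic

/-! ### The field `ℚ(ζ₄)`: coordinates and square classes -/

namespace ZetaFour

variable {K : Type*} [Field K] [Algebra ℚ K]

/-- In a `ℚ`-algebra field, `1` and a square root `ι` of `-1` are linearly independent over `ℚ`
(`ι ∉ ℚ` since `-1` is not a rational square). [folklore] -/
private theorem linearIndependent_one_iota {ι : K} (hι : ι * ι = -1) :
    LinearIndependent ℚ ![(1 : K), ι] := by
  rw [LinearIndependent.pair_iff]
  intro s t hst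
  by_cases ht : t = 0
  · subst ht
    simp only [zero_smul, add_zero, smul_eq_zero, one_ne_zero, or_false] at hst
    exact ⟨hst, rfl⟩
  · exfalso
    have h1 : t • ι = -(s • (1 : K)) := by linear_combination hst
    rw [Algebra.smul_def, Algebra.smul_def, mul_one] at h1
    have ht' : (algebraMap ℚ K t) ≠ 0 := by
      rw [ne_eq, map_eq_zero_iff _ (algebraMap ℚ K).injective]; exact ht
    have hι' : ι = algebraMap ℚ K (-s / t) := by
      rw [map_div₀, map_neg, eq_div_iff ht']
      linear_combination h1
    have h2 : algebraMap ℚ K ((-s / t) * (-s / t)) = algebraMap ℚ K (-1) := by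
      rw [map_mul, ← hι', hι, map_neg, map_one]
    have h3 := (algebraMap ℚ K).injective h2
    nlinarith [mul_self_nonneg (-s / t)]

/-- **Coordinates in `ℚ(ζ₄)`.** If `[K : ℚ] = 2` and `ι ∈ K`, `ι² = -1`, every element of `K` is
`a + b ι` with `a, b ∈ ℚ`. [folklore] -/
private theorem exists_eq_add_mul (hK : Module.finrank ℚ K = 2) {ι : K} (hι : ι * ι = -1) (x : K) :
    ∃ a b : ℚ, x = algebraMap ℚ K a + algebraMap ℚ K b * ι := by
  have : Module.Finite ℚ K := Module.finite_of_finrank_pos (by omega)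
  have hli := linearIndependent_one_iota hι
  have hsp := hli.span_eq_top_of_card_eq_finrank' (by simp [hK])
  have hx : x ∈ Submodule.span ℚ (Set.range ![(1 : K), ι]) := by
    rw [hsp]; exact Submodule.mem_top
  rw [Matrix.range_cons, Matrix.range_cons, Matrix.range_empty, Set.union_empty,
    Set.union_singleton, Submodule.mem_span_pair] at hx
  obtain ⟨a, b, hab⟩ := hx
  refine ⟨b, a, ?_⟩
  rw [← hab, Algebra.smul_def, Algebra.smul_def, mul_one, add_comm]

/-- **Uniqueness of coordinates in `ℚ(ζ₄)`.** [folklore] -/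
private theorem eq_and_eq_of_add_mul_eq {ι : K} (hι : ι * ι = -1) {a b a' b' : ℚ}
    (h : algebraMap ℚ K a + algebraMap ℚ K b * ι = algebraMap ℚ K a' + algebraMap ℚ K b' * ι) :
    a = a' ∧ b = b' := by
  have hli := linearIndependent_one_iota hι
  rw [LinearIndependent.pair_iff] at hli
  have h0 : (a - a') • (1 : K) + (b - b') • ι = 0 := by
    rw [Algebra.smul_def, Algebra.smul_def, mul_one, map_sub, map_sub]
    linear_combination h
  obtain ⟨h1, h2⟩ := hli _ _ h0
  exact ⟨sub_eq_zero.mp h1, sub_eq_zero.mp h2⟩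

/-- The square of `a + b ι` is `(a² - b²) + 2ab ι`. [folklore] -/
private theorem add_mul_sq {ι : K} (hι : ι * ι = -1) (a b : ℚ) :
    (algebraMap ℚ K a + algebraMap ℚ K b * ι) * (algebraMap ℚ K a + algebraMap ℚ K b * ι) =
      algebraMap ℚ K (a * a - b * b) + algebraMap ℚ K (2 * a * b) * ι := by
  simp only [map_sub, map_mul, map_ofNat]
  linear_combination (algebraMap ℚ K b) * (algebraMap ℚ K b) * hι

/-- `2` is not the square of a rational number. [folklore] -/
private theorem not_isSquare_two : ¬ IsSquare (2 : ℚ) := by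
  have h := not_isSquare_ratCast_prime Nat.prime_two
  rwa [Nat.cast_ofNat] at h

/-- **Square classes in `ℚ(ζ₄)`, I:** a positive rational which is a square in `ℚ(ζ₄)` is a square
in `ℚ` (`(a + bι)² = r` forces `ab = 0`, and `a = 0` gives `r = -b² ≤ 0`). [folklore] -/
private theorem isSquare_of_isSquare_algebraMap (hK : Module.finrank ℚ K = 2) {ι : K} (hι : ι * ι = -1)
    {r : ℚ} (hr : 0 < r) (h : IsSquare (algebraMap ℚ K r)) : IsSquare r := by
  obtain ⟨z, hz⟩ := h
  obtain ⟨a, b, rfl⟩ := exists_eq_add_mul hK hι z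
  rw [add_mul_sq hι] at hz
  have hz' : algebraMap ℚ K r + algebraMap ℚ K 0 * ι =
      algebraMap ℚ K (a * a - b * b) + algebraMap ℚ K (2 * a * b) * ι := by
    rw [map_zero, zero_mul, add_zero]; exact hz
  obtain ⟨h1, h2⟩ := eq_and_eq_of_add_mul_eq hι hz'
  rcases mul_eq_zero.mp h2.symm with h3 | h3
  · rcases mul_eq_zero.mp h3 with h4 | h4
    · norm_num at h4
    · subst h4; nlinarith [mul_self_nonneg b]
  · subst h3; exact ⟨a, by linarith⟩

/-- **Square classes in `ℚ(ζ₄)`, II:** if `ι r` is a square in `ℚ(ζ₄)` for a positive rational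
`r`, then `2r` is a square in `ℚ` (`(a + bι)² = ι r` forces `a = ±b`, `r = 2a²`; e.g.
`2ι = (1 + ι)²`). [folklore] -/
private theorem isSquare_two_mul_of_isSquare_iota_mul (hK : Module.finrank ℚ K = 2) {ι : K}
    (hι : ι * ι = -1) {r : ℚ} (hr : 0 < r) (h : IsSquare (ι * algebraMap ℚ K r)) :
    IsSquare (2 * r) := by
  obtain ⟨z, hz⟩ := h
  obtain ⟨a, b, rfl⟩ := exists_eq_add_mul hK hι z
  rw [add_mul_sq hι] at hz
  have hz' : algebraMap ℚ K 0 + algebraMap ℚ K r * ι =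
      algebraMap ℚ K (a * a - b * b) + algebraMap ℚ K (2 * a * b) * ι := by
    rw [map_zero, zero_add, mul_comm]; exact hz
  obtain ⟨h1, h2⟩ := eq_and_eq_of_add_mul_eq hι hz'
  have hab : (a - b) * (a + b) = 0 := by linear_combination h1.symm
  rcases mul_eq_zero.mp hab with h3 | h3
  · exact ⟨2 * a, by linear_combination 2 * h2 - 4 * a * h3⟩
  · nlinarith [mul_self_nonneg a, h2, h3]

/-- **Square classes in `ℚ(ζ₄)`, III:** `(1 + ι) r` is a square in `ℚ(ζ₄)` only for `r = 0`
(`(a + bι)² = (1 + ι) r` forces `(a - b)² = 2b²`, and `2` is not a rational square). [folklore] -/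
private theorem eq_zero_of_isSquare_one_add_iota_mul (hK : Module.finrank ℚ K = 2) {ι : K}
    (hι : ι * ι = -1) {r : ℚ} (h : IsSquare ((1 + ι) * algebraMap ℚ K r)) : r = 0 := by
  obtain ⟨z, hz⟩ := h
  obtain ⟨a, b, rfl⟩ := exists_eq_add_mul hK hι z
  rw [add_mul_sq hι] at hz
  have hz' : algebraMap ℚ K r + algebraMap ℚ K r * ι =
      algebraMap ℚ K (a * a - b * b) + algebraMap ℚ K (2 * a * b) * ι := by
    rw [← hz]; ring
  obtain ⟨h1, h2⟩ := eq_and_eq_of_add_mul_eq hι hz'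
  by_cases hb : b = 0
  · subst hb
    have ha : a * a = 0 := by linarith
    have := mul_self_eq_zero.mp ha
    subst this; linarith
  · exfalso
    apply not_isSquare_two
    refine ⟨(a - b) / b, ?_⟩
    field_simp
    linear_combination h1 - h2

/-- **Square classes in `ℚ(ζ₄)`, IV:** `ι (1 + ι) r = (ι - 1) r` is a square in `ℚ(ζ₄)` only for
`r = 0` (`(a + bι)² = (ι - 1) r` forces `(a + b)² = 2b²`). [folklore] -/
private theorem eq_zero_of_isSquare_iota_mul_one_add_iota_mul (hK : Module.finrank ℚ K = 2) {ι : K}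
    (hι : ι * ι = -1) {r : ℚ} (h : IsSquare (ι * (1 + ι) * algebraMap ℚ K r)) : r = 0 := by
  obtain ⟨z, hz⟩ := h
  obtain ⟨a, b, rfl⟩ := exists_eq_add_mul hK hι z
  rw [add_mul_sq hι] at hz
  have hz' : algebraMap ℚ K (-r) + algebraMap ℚ K r * ι =
      algebraMap ℚ K (a * a - b * b) + algebraMap ℚ K (2 * a * b) * ι := by
    rw [← hz, map_neg]; linear_combination (-(algebraMap ℚ K r)) * hι
  obtain ⟨h1, h2⟩ := eq_and_eq_of_add_mul_eq hι hz'
  by_cases hb : b = 0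
  · subst hb
    have ha : a * a = 0 := by linarith
    have := mul_self_eq_zero.mp ha
    subst this; linarith
  · exfalso
    apply not_isSquare_two
    refine ⟨(a + b) / b, ?_⟩
    field_simp
    linear_combination h1 + h2

end ZetaFour

/-! ### Square classes of products of distinct primes in `ℚ` -/

section PrimeProducts

/-- The valuation at `p_{j₀}` of a product of distinct primes containing `p_{j₀}` is `1`.
[folklore] -/
private theorem padicValRat_prod_primes_eq_one {n : ℕ} (pr : Fin n → ℕ) (hpr : ∀ j, (pr j).Prime)
    (hinj : Function.Injective pr) (S : Finset (Fin n)) {j₀ : Fin n} (hj₀ : j₀ ∈ S) :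
    padicValRat (pr j₀) (∏ j ∈ S, (pr j : ℚ)) = 1 := by
  classical
  haveI : Fact (pr j₀).Prime := ⟨hpr j₀⟩
  rw [Literature.NumberTheory.DiophantineGeometry.Dioph.padicValRat_finset_prod (pr j₀) S _
    fun j _ => by exact_mod_cast (hpr j).ne_zero]
  have hval : ∀ j, padicValRat (pr j₀) (pr j : ℚ) = if j = j₀ then 1 else 0 := by
    intro j
    rw [padicValRat.of_nat]
    by_cases hj : j = j₀
    · subst hj; simp [padicValNat_self]
    · haveI : Fact (pr j).Prime := ⟨hpr j⟩
      rw [if_neg hj, padicValNat_primes (fun h => hj (hinj h).symm)]; simp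
  simp only [hval, Finset.sum_ite_eq', if_pos hj₀]

/-- A product of distinct primes is positive. [folklore] -/
private theorem prod_primes_pos {n : ℕ} (pr : Fin n → ℕ) (hpr : ∀ j, (pr j).Prime) (S : Finset (Fin n)) :
    (0 : ℚ) < ∏ j ∈ S, (pr j : ℚ) :=
  Finset.prod_pos fun j _ => by exact_mod_cast (hpr j).pos

/-- A product of a non-empty set of distinct primes is not a square in `ℚ`. [folklore] -/
private theorem not_isSquare_prod_primes {n : ℕ} (pr : Fin n → ℕ) (hpr : ∀ j, (pr j).Prime)
    (hinj : Function.Injective pr) (S : Finset (Fin n)) (hS : S.Nonempty) :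
    ¬ IsSquare (∏ j ∈ S, (pr j : ℚ)) := by
  obtain ⟨j₀, hj₀⟩ := hS
  rintro ⟨z, hz⟩
  haveI : Fact (pr j₀).Prime := ⟨hpr j₀⟩
  have h1 := padicValRat_prod_primes_eq_one pr hpr hinj S hj₀
  have hz0 : z ≠ 0 := by
    rintro rfl; rw [mul_zero] at hz; exact (prod_primes_pos pr hpr S).ne' hz
  rw [hz, padicValRat.mul hz0 hz0] at h1
  omega

/-- Twice a product of distinct ODD primes (possibly empty) is not a square in `ℚ`. [folklore] -/
private theorem not_isSquare_two_mul_prod_oddPrimes {n : ℕ} (pr : Fin n → ℕ) (hpr : ∀ j, (pr j).Prime)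
    (hodd : ∀ j, pr j ≠ 2) (hinj : Function.Injective pr) (S : Finset (Fin n)) :
    ¬ IsSquare (2 * ∏ j ∈ S, (pr j : ℚ)) := by
  rcases S.eq_empty_or_nonempty with rfl | ⟨j₀, hj₀⟩
  · rw [Finset.prod_empty, mul_one]; exact ZetaFour.not_isSquare_two
  · rintro ⟨z, hz⟩
    haveI : Fact (pr j₀).Prime := ⟨hpr j₀⟩
    have h1 := padicValRat_prod_primes_eq_one pr hpr hinj S hj₀
    have hz0 : z ≠ 0 := by
      rintro rfl; rw [mul_zero] at hz
      exact (mul_pos two_pos (prod_primes_pos pr hpr S)).ne' hz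
    have h2 : padicValRat (pr j₀) (2 * ∏ j ∈ S, (pr j : ℚ)) = 1 := by
      rw [padicValRat.mul two_ne_zero (prod_primes_pos pr hpr S).ne', h1]
      have : padicValRat (pr j₀) ((2 : ℕ) : ℚ) = 0 := by
        rw [padicValRat.of_nat, padicValNat_primes (hodd j₀)]; simp
      rw [Nat.cast_ofNat] at this
      rw [this, zero_add]
    rw [hz, padicValRat.mul hz0 hz0] at h2
    omega

/-- Splitting a product over `T ⊆ Fin (n+1)` into the factor at `0` and the factors at successors.
[folklore] -/
private theorem prod_eq_ite_mul_prod_filter_succ {M : Type*} [CommMonoid M] {n : ℕ} (g : Fin (n + 1) → M)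
    (T : Finset (Fin (n + 1))) :
    ∏ i ∈ T, g i = (if (0 : Fin (n + 1)) ∈ T then g 0 else 1) *
      ∏ j ∈ Finset.univ.filter (fun j : Fin n => j.succ ∈ T), g j.succ := by
  classical
  have h : ∏ i ∈ T, g i = ∏ i : Fin (n + 1), (if i ∈ T then g i else 1) := by
    rw [Finset.prod_ite_mem, Finset.univ_inter]
  rw [h, Fin.prod_univ_succ, Finset.prod_filter]

end PrimeProducts

/-! ### The models `ℚ(ζ₄)`, `ℚ(ζ₆)` inside a field have degree `2` -/

section Models

/-- **A root of a rational quadratic with negative discriminant generates a quadratic field:** if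
`x ∈ L ⊇ ℚ` satisfies `x² + a x + b = 0` with `a² < 4b`, then `[ℚ(x) : ℚ] = 2` (e.g. `ι² = -1`:
`a = 0, b = 1`; `ζ₆² − ζ₆ + 1 = 0`: `a = -1, b = 1`), so the hypothesis `[K : ℚ] = 2` of this file
holds for `K = ℚ⟮ι⟯`, `ℚ⟮ζ₆⟯`. [folklore] -/
private theorem finrank_adjoin_simple_eq_two_of_quadratic {L : Type*} [Field L] [Algebra ℚ L] {x : L}
    {a b : ℚ} (hx : x * x + algebraMap ℚ L a * x + algebraMap ℚ L b = 0) (hdisc : a * a < 4 * b) :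
    Module.finrank ℚ ↥ℚ⟮x⟯ = 2 := by
  set p : ℚ[X] := X ^ 2 + C a * X + C b with hp
  have hpm : p.Monic := by rw [hp]; monicity!
  have hroot : aeval x p = 0 := by
    simp only [hp, map_add, map_mul, map_pow, aeval_X, aeval_C]
    rw [← hx]; ring
  have hint : IsIntegral ℚ x := ⟨p, hpm, by rwa [aeval_def] at hroot⟩
  rw [adjoin.finrank hint]
  apply le_antisymm
  · have h := minpoly.degree_le_of_ne_zero ℚ x hpm.ne_zero hroot
    have hdegp : p.degree ≤ 2 := by rw [hp]; compute_degree!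
    exact natDegree_le_iff_degree_le.mpr (h.trans hdegp)
  · rw [minpoly.two_le_natDegree_iff hint]
    rintro ⟨r, hr⟩
    rw [← hr, ← map_mul, ← map_mul, ← map_add, ← map_add, map_eq_zero_iff _
      (algebraMap ℚ L).injective] at hx
    nlinarith [sq_nonneg (2 * r + a)]

end Models

/-! ### Stewart–Yu 1991, Lemma 3, the case `q = 2`, `K = ℚ(ζ₄)` -/

section LemmaThreeZetaFour

variable {K : Type*} [Field K] [Algebra ℚ K]

/-- Casting a product of primes selected by a predicate into `K`. [folklore] -/
private theorem prod_filter_natCast_eq_algebraMap {n : ℕ} (pr : Fin n → ℕ) (P : Fin n → Prop)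
    [DecidablePred P] :
    ∏ j ∈ Finset.univ.filter P, (pr j : K) =
      algebraMap ℚ K (∏ j ∈ Finset.univ.filter P, (pr j : ℚ)) := by
  rw [map_prod]
  simp_rw [map_natCast]

/-- **Independent square classes in `ℚ(ζ₄)`: `ζ₄` and distinct odd primes.** If `[K : ℚ] = 2`,
`ι ∈ K` with `ι² = -1`, and `p₁, …, pₙ` are distinct odd primes, then no product of a non-empty
subfamily of `(ι, p₁, …, pₙ)` is a square in `K` (Kummer condition (2.15) of Yu 1990 for
`K = ℚ(ζ₄)`, `q = 2`, `α₀ = ζ₄`, in the independence form consumed by the Baker–Stark descent).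
[cite: StewartYu1991, Lemma 3 (p. 227)] -/
theorem not_isSquare_prod_zeta4_oddPrimes (hK : Module.finrank ℚ K = 2) {ι : K}
    (hι : ι * ι = -1) {n : ℕ} (pr : Fin n → ℕ) (hpr : ∀ j, (pr j).Prime) (hodd : ∀ j, pr j ≠ 2)
    (hinj : Function.Injective pr) (T : Finset (Fin (n + 1))) (hT : T.Nonempty) :
    ¬ IsSquare (∏ i ∈ T, (Fin.cons ι (fun j => (pr j : K)) : Fin (n + 1) → K) i) := by
  classical
  rw [prod_eq_ite_mul_prod_filter_succ]
  simp only [Fin.cons_zero, Fin.cons_succ]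
  rw [prod_filter_natCast_eq_algebraMap]
  set S : Finset (Fin n) := Finset.univ.filter (fun j : Fin n => j.succ ∈ T) with hS
  set r : ℚ := ∏ j ∈ S, (pr j : ℚ) with hr
  have hr0 : 0 < r := prod_primes_pos pr hpr S
  by_cases h0 : (0 : Fin (n + 1)) ∈ T
  · rw [if_pos h0]
    intro hsq
    exact not_isSquare_two_mul_prod_oddPrimes pr hpr hodd hinj S
      (ZetaFour.isSquare_two_mul_of_isSquare_iota_mul hK hι hr0 hsq)
  · rw [if_neg h0, one_mul]
    intro hsq
    have hSne : S.Nonempty := by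
      obtain ⟨i, hi⟩ := hT
      refine ⟨i.pred (fun h => h0 (h ▸ hi)), ?_⟩
      rw [hS, Finset.mem_filter]
      exact ⟨Finset.mem_univ _, by rw [Fin.succ_pred]; exact hi⟩
    exact not_isSquare_prod_primes pr hpr hinj S hSne
      (ZetaFour.isSquare_of_isSquare_algebraMap hK hι hr0 hsq)

/-- **Independent square classes in `ℚ(ζ₄)`: `ζ₄`, `1 + ζ₄` and distinct odd primes.** If
`[K : ℚ] = 2`, `ι ∈ K` with `ι² = -1`, and `p₁, …, pₙ` are distinct odd primes, then no product of
a non-empty subfamily of `(ι, 1 + ι, p₁, …, pₙ)` is a square in `K` — the generator `2` of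
Stewart–Yu is replaced by `1 + i` (`2⁴ = (1 + i)⁸`), because `2 ι = (1 + ι)²` IS a square.
[cite: StewartYu1991, Lemma 3 (p. 227)] -/
theorem not_isSquare_prod_zeta4_onePlusZeta4_oddPrimes (hK : Module.finrank ℚ K = 2) {ι : K}
    (hι : ι * ι = -1) {n : ℕ} (pr : Fin n → ℕ) (hpr : ∀ j, (pr j).Prime) (hodd : ∀ j, pr j ≠ 2)
    (hinj : Function.Injective pr) (T : Finset (Fin (n + 2))) (hT : T.Nonempty) :
    ¬ IsSquare (∏ i ∈ T,
      (Fin.cons ι (Fin.cons (1 + ι) (fun j => (pr j : K))) : Fin (n + 2) → K) i) := by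
  classical
  rw [prod_eq_ite_mul_prod_filter_succ]
  simp only [Fin.cons_zero, Fin.cons_succ]
  set T₁ : Finset (Fin (n + 1)) := Finset.univ.filter (fun j : Fin (n + 1) => j.succ ∈ T) with hT₁
  rw [prod_eq_ite_mul_prod_filter_succ]
  simp only [Fin.cons_zero, Fin.cons_succ]
  rw [prod_filter_natCast_eq_algebraMap]
  set S : Finset (Fin n) := Finset.univ.filter (fun j : Fin n => j.succ ∈ T₁) with hS
  set r : ℚ := ∏ j ∈ S, (pr j : ℚ) with hr
  have hr0 : 0 < r := prod_primes_pos pr hpr S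
  by_cases h1 : (0 : Fin (n + 1)) ∈ T₁
  · -- the factor `1 + ι` is present: `(1 + ι) r` and `ι (1 + ι) r` are never squares
    rw [if_pos h1]
    by_cases h0 : (0 : Fin (n + 2)) ∈ T
    · rw [if_pos h0, ← mul_assoc]
      intro hsq
      exact hr0.ne' (ZetaFour.eq_zero_of_isSquare_iota_mul_one_add_iota_mul hK hι hsq)
    · rw [if_neg h0, one_mul]
      intro hsq
      exact hr0.ne' (ZetaFour.eq_zero_of_isSquare_one_add_iota_mul hK hι hsq)
  · rw [if_neg h1, one_mul]
    by_cases h0 : (0 : Fin (n + 2)) ∈ T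
    · rw [if_pos h0]
      intro hsq
      exact not_isSquare_two_mul_prod_oddPrimes pr hpr hodd hinj S
        (ZetaFour.isSquare_two_mul_of_isSquare_iota_mul hK hι hr0 hsq)
    · rw [if_neg h0, one_mul]
      intro hsq
      have hSne : S.Nonempty := by
        obtain ⟨i, hi⟩ := hT
        have hi0 : i ≠ 0 := fun h => h0 (h ▸ hi)
        set i₁ : Fin (n + 1) := i.pred hi0 with hi₁
        have hi₁T : i₁ ∈ T₁ := by
          rw [hT₁, Finset.mem_filter]
          exact ⟨Finset.mem_univ _, by rw [hi₁, Fin.succ_pred]; exact hi⟩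
        have hi₁0 : i₁ ≠ 0 := fun h => h1 (h ▸ hi₁T)
        refine ⟨i₁.pred hi₁0, ?_⟩
        rw [hS, Finset.mem_filter]
        exact ⟨Finset.mem_univ _, by rw [Fin.succ_pred]; exact hi₁T⟩
      exact not_isSquare_prod_primes pr hpr hinj S hSne
        (ZetaFour.isSquare_of_isSquare_algebraMap hK hι hr0 hsq)

variable {L : Type*} [Field L] [Algebra K L]

/-- `2 ≠ 0` in a field extension of a `ℚ`-algebra field. [folklore] -/
private theorem two_ne_zero_of_algebra_rat (K₀ : Type*) {L₀ : Type*} [Field K₀] [Algebra ℚ K₀] [Field L₀]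
    [Algebra K₀ L₀] : (2 : L₀) ≠ 0 := by
  haveI : CharZero K₀ := charZero_of_injective_algebraMap (algebraMap ℚ K₀).injective
  rw [show (2 : L₀) = algebraMap K₀ L₀ 2 from (map_ofNat (algebraMap K₀ L₀) 2).symm]
  exact (_root_.map_ne_zero _).mpr two_ne_zero

/-- **Stewart–Yu 1991, Lemma 3 (case `q = 2`, `α₀ = ζ₄`, odd primes).** Let `K = ℚ(ζ₄)`
(any field with `[K : ℚ] = 2` and `ι ∈ K`, `ι² = -1`) and let `α₁ < ⋯ < αₙ` be odd primes
(here: distinct primes `≠ 2`). Then for any square roots `y₀` of `ι` and `yⱼ` of `αⱼ` in an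
extension `L ⊇ K`: `[K(α₀^{1/2}, α₁^{1/2}, …, αₙ^{1/2}) : K] = 2^{n+1}`. (Printed: "Let `q = 2` and
`α₀ = ζ₄` … Then `[K(α₀^{1/q}, α₁^{1/q}, …, αₙ^{1/q}) : K] = q^{n+1}` except when `q = 2`,
`α₀ = ζ₄`, and `α₁ = 2`".) Proof as printed, by the Baker–Stark descent (`Multiquadratic`) from
the square-class independence `not_isSquare_prod_zeta4_oddPrimes`.
[cite: StewartYu1991, Lemma 3 (p. 227)] -/
theorem finrank_adjoin_sqrt_zeta4_oddPrimes (hK : Module.finrank ℚ K = 2) {ι : K}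
    (hι : ι * ι = -1) {n : ℕ} (pr : Fin n → ℕ) (hpr : ∀ j, (pr j).Prime) (hodd : ∀ j, pr j ≠ 2)
    (hinj : Function.Injective pr) (y : Fin (n + 1) → L)
    (hy : ∀ j, y j * y j = algebraMap K L ((Fin.cons ι (fun j => (pr j : K)) : Fin (n + 1) → K) j)) :
    Module.finrank K ↥(IntermediateField.adjoin K (Set.range y)) = 2 ^ (n + 1) :=
  Multiquadratic.finrank_adjoin_eq_two_pow_of_mul_self_eq_base (two_ne_zero_of_algebra_rat K)
    _ y hy (not_isSquare_prod_zeta4_oddPrimes hK hι pr hpr hodd hinj)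

/-- **Stewart–Yu 1991, Lemma 3 (case `q = 2`, `α₀ = ζ₄`, `α₁ = 2`).** Let `K = ℚ(ζ₄)` (any field
with `[K : ℚ] = 2` and `ι ∈ K`, `ι² = -1`) and let `α₂, …, α_{n+1}` be distinct odd primes. Then,
with `α₁ = 2` replaced by `1 + i` ("in this case
`[K(α₀^{1/2}, (1 + i)^{1/2}, α₂^{1/2}, …, αₙ^{1/2}) : K] = 2^{n+1}`"), for any square roots `y₀` of
`ι`, `y₁` of `1 + ι` and `y_{j+2}` of the odd primes in an extension `L ⊇ K`:
`[K(y₀, y₁, …, y_{n+1}) : K] = 2^{n+2}` (indexing: `n` odd primes). As printed, via the Baker–Stark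
descent from `not_isSquare_prod_zeta4_onePlusZeta4_oddPrimes`; in the application (p. 228) one
notes `2⁴ = (1 + i)⁸`. [cite: StewartYu1991, Lemma 3 (p. 227)] -/
theorem finrank_adjoin_sqrt_zeta4_onePlusZeta4_oddPrimes (hK : Module.finrank ℚ K = 2) {ι : K}
    (hι : ι * ι = -1) {n : ℕ} (pr : Fin n → ℕ) (hpr : ∀ j, (pr j).Prime) (hodd : ∀ j, pr j ≠ 2)
    (hinj : Function.Injective pr) (y : Fin (n + 2) → L)
    (hy : ∀ j, y j * y j = algebraMap K L
      ((Fin.cons ι (Fin.cons (1 + ι) (fun j => (pr j : K))) : Fin (n + 2) → K) j)) :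
    Module.finrank K ↥(IntermediateField.adjoin K (Set.range y)) = 2 ^ (n + 2) :=
  Multiquadratic.finrank_adjoin_eq_two_pow_of_mul_self_eq_base (two_ne_zero_of_algebra_rat K)
    _ y hy (not_isSquare_prod_zeta4_onePlusZeta4_oddPrimes hK hι pr hpr hodd hinj)

omit [Algebra ℚ K] in
/-- The printed identity behind the replacement of the generator `2` by `1 + i`:
`(1 + ι)⁸ = 2⁴` (indeed `(1 + ι)² = 2ι`). [cite: StewartYu1991, §3 (p. 228)] -/
theorem one_add_iota_pow_eight {ι : K} (hι : ι * ι = -1) : (1 + ι) ^ 8 = 2 ^ 4 := by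
  have h2 : (1 + ι) ^ 2 = 2 * ι := by linear_combination hι
  calc (1 + ι) ^ 8 = ((1 + ι) ^ 2) ^ 4 := by ring
    _ = 2 ^ 4 := by rw [h2]; linear_combination (16 * ι * ι - 16) * hι

/-! #### The model `K = ℚ⟮ι⟯ ⊂ L` -/

/-- In the model `K = ℚ(ι) ⊂ L`, the generators `ι, p₁, …` of `K` map to `ι, p₁, …` in `L`.
[folklore] -/
private theorem algebraMap_cons_adjoin {L : Type*} [Field L] [Algebra ℚ L] (x : L) {m : ℕ}
    (g : Fin m → ℕ) (j : Fin (m + 1)) :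
    algebraMap ↥ℚ⟮x⟯ L ((Fin.cons (⟨x, mem_adjoin_simple_self ℚ x⟩ : ↥ℚ⟮x⟯)
      (fun i => (g i : ↥ℚ⟮x⟯)) : Fin (m + 1) → ↥ℚ⟮x⟯) j) =
      (Fin.cons x (fun i => (g i : L)) : Fin (m + 1) → L) j := by
  refine Fin.cases ?_ (fun i => ?_) j
  · simp only [Fin.cons_zero]; rfl
  · simp only [Fin.cons_succ, map_natCast]

/-- **Stewart–Yu 1991, Lemma 3 (`q = 2`, odd primes) in the model `K = ℚ(ι) ⊂ L`:** for a field
`L ⊇ ℚ` containing `ι` with `ι² = -1`, distinct odd primes `p₁, …, pₙ`, and square roots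
`y₀² = ι`, `yⱼ² = pⱼ` in `L`: `[ℚ(ι)(y₀, …, yₙ) : ℚ(ι)] = 2^{n+1}` — hypothesis-free form of
`finrank_adjoin_sqrt_zeta4_oddPrimes` (`[ℚ(ι) : ℚ] = 2` by `X² + 1`).
[cite: StewartYu1991, Lemma 3 (p. 227)] -/
theorem finrank_adjoin_sqrt_zeta4_oddPrimes_model {L : Type*} [Field L] [Algebra ℚ L] {ι : L}
    (hι : ι * ι = -1) {n : ℕ} (pr : Fin n → ℕ) (hpr : ∀ j, (pr j).Prime) (hodd : ∀ j, pr j ≠ 2)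
    (hinj : Function.Injective pr) (y : Fin (n + 1) → L)
    (hy : ∀ j, y j * y j = (Fin.cons ι (fun j => (pr j : L)) : Fin (n + 1) → L) j) :
    Module.finrank ↥ℚ⟮ι⟯ ↥(IntermediateField.adjoin ↥ℚ⟮ι⟯ (Set.range y)) = 2 ^ (n + 1) := by
  have hK : Module.finrank ℚ ↥ℚ⟮ι⟯ = 2 :=
    finrank_adjoin_simple_eq_two_of_quadratic (a := 0) (b := 1)
      (by rw [map_zero, map_one, zero_mul, add_zero, hι, neg_add_cancel]) (by norm_num)
  have hιK : (⟨ι, mem_adjoin_simple_self ℚ ι⟩ : ↥ℚ⟮ι⟯) * ⟨ι, mem_adjoin_simple_self ℚ ι⟩ = -1 :=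
    Subtype.ext (by simpa using hι)
  exact finrank_adjoin_sqrt_zeta4_oddPrimes (by convert hK; exact Subsingleton.elim _ _) hιK pr hpr hodd hinj y
    fun j => by rw [hy j, algebraMap_cons_adjoin]

/-- **Stewart–Yu 1991, Lemma 3 (`q = 2`, `α₁ = 2 ↦ 1 + i`) in the model `K = ℚ(ι) ⊂ L`:** for a
field `L ⊇ ℚ` containing `ι` with `ι² = -1`, distinct odd primes `p₁, …, pₙ`, and square roots
`y₀² = ι`, `y₁² = 1 + ι`, `y_{j+2}² = pⱼ` in `L`: `[ℚ(ι)(y₀, …, y_{n+1}) : ℚ(ι)] = 2^{n+2}`.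
[cite: StewartYu1991, Lemma 3 (p. 227)] -/
theorem finrank_adjoin_sqrt_zeta4_onePlusZeta4_oddPrimes_model {L : Type*} [Field L] [Algebra ℚ L]
    {ι : L} (hι : ι * ι = -1) {n : ℕ} (pr : Fin n → ℕ) (hpr : ∀ j, (pr j).Prime)
    (hodd : ∀ j, pr j ≠ 2) (hinj : Function.Injective pr) (y : Fin (n + 2) → L)
    (hy : ∀ j, y j * y j =
      (Fin.cons ι (Fin.cons (1 + ι) (fun j => (pr j : L))) : Fin (n + 2) → L) j) :
    Module.finrank ↥ℚ⟮ι⟯ ↥(IntermediateField.adjoin ↥ℚ⟮ι⟯ (Set.range y)) = 2 ^ (n + 2) := by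
  have hK : Module.finrank ℚ ↥ℚ⟮ι⟯ = 2 :=
    finrank_adjoin_simple_eq_two_of_quadratic (a := 0) (b := 1)
      (by rw [map_zero, map_one, zero_mul, add_zero, hι, neg_add_cancel]) (by norm_num)
  set ιK : ↥ℚ⟮ι⟯ := ⟨ι, mem_adjoin_simple_self ℚ ι⟩ with hιKdef
  have hιK : ιK * ιK = -1 := Subtype.ext (by simpa using hι)
  refine finrank_adjoin_sqrt_zeta4_onePlusZeta4_oddPrimes (by convert hK; exact Subsingleton.elim _ _) hιK pr hpr hodd hinj y
    fun j => ?_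
  rw [hy j]
  refine Fin.cases ?_ (fun i => ?_) j
  · simp only [Fin.cons_zero]; rfl
  · simp only [Fin.cons_succ]
    refine Fin.cases ?_ (fun i' => ?_) i
    · simp only [Fin.cons_zero, map_add, map_one]; rfl
    · simp only [Fin.cons_succ, map_natCast]

end LemmaThreeZetaFour


/-! ### Extensions by cube roots with independent cube classes -/

namespace Multicubic

variable {K L : Type*} [Field K] [Field L] [Algebra K L]

/-- An element whose cube lies in `F` is integral over `F`. [folklore] -/
private theorem isIntegral_of_cube_mem (F : IntermediateField K L) {y : L} (hy3 : y ^ 3 ∈ F) :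
    IsIntegral F y := by
  have h : IsIntegral F (y ^ 3) := by
    have : y ^ 3 = algebraMap F L ⟨y ^ 3, hy3⟩ := rfl
    rw [this]; exact isIntegral_algebraMap
  exact h.of_pow (by norm_num)

/-- The polynomial `X³ − y³` over `F` kills `y`. [folklore] -/
private theorem aeval_X_cube_sub_C (F : IntermediateField K L) {y : L} (hy3 : y ^ 3 ∈ F) :
    aeval y (X ^ 3 - C (⟨y ^ 3, hy3⟩ : F)) = 0 := by
  simp only [map_sub, map_pow, aeval_X, aeval_C, IntermediateField.algebraMap_apply]
  exact sub_self _

/-- **A pure cubic step:** if `y³ ∈ F` is not the cube of an element of `F`, then `X³ − y³` is the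
minimal polynomial of `y` over `F` — the case `n = 3` of the Vahlen–Capelli theorem quoted by Yu
("`xⁿ − α` is reducible if, and only if, `α = β^d` (`d ∣ n, > 1; β ∈ F`) or `4 ∣ n`, `α = −4γ⁴`");
here via Mathlib's `X_pow_sub_C_irreducible_iff_of_prime`.
[cite: Yu1990, Vahlen–Capelli Theorem (p. 28)] -/
theorem minpoly_eq_of_cube_mem (F : IntermediateField K L) {y : L} (hy3 : y ^ 3 ∈ F)
    (hnc : ∀ z ∈ F, z ^ 3 ≠ y ^ 3) : minpoly F y = X ^ 3 - C (⟨y ^ 3, hy3⟩ : F) := by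
  have hirr : Irreducible (X ^ 3 - C (⟨y ^ 3, hy3⟩ : F)) := by
    refine (X_pow_sub_C_irreducible_iff_of_prime Nat.prime_three).mpr fun b hb => ?_
    apply hnc (b : L) b.2
    have := congrArg (fun z : F => (z : L)) hb
    simpa using this
  exact (minpoly.eq_of_irreducible_of_monic hirr (aeval_X_cube_sub_C F hy3)
    (monic_X_pow_sub_C _ three_ne_zero)).symm

/-- **A pure cubic step has degree `3`** (Vahlen–Capelli for `n = 3`).
[cite: Yu1990, Vahlen–Capelli Theorem (p. 28)] -/
theorem finrank_adjoin_simple_of_cube_mem (F : IntermediateField K L) {y : L} (hy3 : y ^ 3 ∈ F)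
    (hnc : ∀ z ∈ F, z ^ 3 ≠ y ^ 3) : Module.finrank F F⟮y⟯ = 3 := by
  rw [adjoin.finrank (isIntegral_of_cube_mem F hy3), minpoly_eq_of_cube_mem F hy3 hnc,
    natDegree_X_pow_sub_C]

/-- Elements of `F(y)` with `y³ ∈ F` are of the form `u + v y + w y²` with `u, v, w ∈ F`.
[folklore] -/
private theorem exists_repr_of_mem_adjoin_simple (F : IntermediateField K L) {y : L} (hy3 : y ^ 3 ∈ F)
    {z : L} (hz : z ∈ F⟮y⟯) : ∃ u ∈ F, ∃ v ∈ F, ∃ w ∈ F, z = u + v * y + w * y ^ 2 := by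
  have hint := isIntegral_of_cube_mem F hy3
  have hz' : z ∈ (F⟮y⟯).toSubalgebra := hz
  rw [adjoin_simple_toSubalgebra_of_isAlgebraic hint.isAlgebraic,
    Algebra.adjoin_singleton_eq_range_aeval, AlgHom.mem_range] at hz'
  obtain ⟨f, rfl⟩ := hz'
  set c : F := ⟨y ^ 3, hy3⟩ with hc
  set p : F[X] := X ^ 3 - C c with hp
  have hpm : p.Monic := monic_X_pow_sub_C _ three_ne_zero
  have hroot : aeval y p = 0 := aeval_X_cube_sub_C F hy3
  have hmod : aeval y (f %ₘ p) = aeval y f := aeval_modByMonic_eq_self_of_root hroot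
  have hp1 : p ≠ 1 := by
    intro h
    have h' := congrArg natDegree h
    rw [hp, natDegree_X_pow_sub_C, natDegree_one] at h'
    exact three_ne_zero h'
  have hpdeg : p.natDegree = 3 := by rw [hp, natDegree_X_pow_sub_C]
  have hdeg : (f %ₘ p).natDegree < 3 := by
    have h := natDegree_modByMonic_lt f hpm hp1
    rwa [hpdeg] at h
  refine ⟨((f %ₘ p).coeff 0 : F), SetLike.coe_mem _, ((f %ₘ p).coeff 1 : F), SetLike.coe_mem _,
    ((f %ₘ p).coeff 2 : F), SetLike.coe_mem _, ?_⟩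
  rw [← hmod]
  conv_lhs => rw [as_sum_range' (f %ₘ p) 3 hdeg]
  simp only [Finset.sum_range_succ, Finset.sum_range_zero, map_add, aeval_monomial,
    IntermediateField.algebraMap_apply, zero_add, pow_zero, mul_one, pow_one]

/-- `1, y, y²` are linearly independent over `F` when `[F(y) : F] = 3`. [folklore] -/
private theorem eq_zero_of_repr_eq_zero (F : IntermediateField K L) {y : L} (hy3 : y ^ 3 ∈ F)
    (hnc : ∀ z ∈ F, z ^ 3 ≠ y ^ 3) {u v w : L} (hu : u ∈ F) (hv : v ∈ F) (hw : w ∈ F)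
    (h : u + v * y + w * y ^ 2 = 0) : u = 0 ∧ v = 0 ∧ w = 0 := by
  set q : F[X] := C (⟨u, hu⟩ : F) + C (⟨v, hv⟩ : F) * X + C (⟨w, hw⟩ : F) * X ^ 2 with hq
  have hroot : aeval y q = 0 := by
    simp only [hq, map_add, map_mul, map_pow, aeval_C, aeval_X, IntermediateField.algebraMap_apply]
    exact h
  by_cases hq0 : q = 0
  · have h0 := congrArg (fun r : F[X] => r.coeff 0) hq0
    have h1 := congrArg (fun r : F[X] => r.coeff 1) hq0
    have h2 := congrArg (fun r : F[X] => r.coeff 2) hq0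
    simp only [hq, coeff_add, coeff_C, coeff_C_mul, coeff_X, coeff_X_pow, coeff_zero] at h0 h1 h2
    norm_num at h0 h1 h2
    exact ⟨congrArg Subtype.val h0, congrArg Subtype.val h1, congrArg Subtype.val h2⟩
  · exfalso
    have hdeg := minpoly.degree_le_of_ne_zero F y hq0 hroot
    rw [minpoly_eq_of_cube_mem F hy3 hnc, degree_X_pow_sub_C (by norm_num)] at hdeg
    have hq2 : q.degree ≤ 2 := by
      rw [hq]
      refine (degree_add_le _ _).trans (max_le ((degree_add_le _ _).trans (max_le ?_ ?_)) ?_)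
      · exact degree_C_le.trans (by norm_num)
      · exact (degree_C_mul_X_le _).trans (by norm_num)
      · exact (degree_C_mul_X_pow_le 2 _)
    have := hdeg.trans hq2
    norm_num at this

/-- **Descent of cubes through a pure cubic step** (characteristic `≠ 3`): if `y³ ∈ F` is not a
cube in `F`, and `x ∈ F` is the cube of an element `z = u + v y + w y²` of `F(y)`, then `z` is a
monomial in `y` and `x = (y³)ᵏ γ³` with `γ ∈ F`, `k ∈ {0, 1, 2}` (comparing coefficients of `z³`:
`w (y³ v³ − u³) = 0`). This is the Baker–Stark Kummer lemma as quoted by Yu, for `p = 3` and two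
generators: "either `K'(αₙ^{1/p})` is an extension of `K'` of degree `p` or
`αₙ = α₁^{j₁} ⋯ α_{n-1}^{j_{n-1}} γᵖ` for some `γ` in `K`" — no cube root of unity in `F` is needed.
[cite: Yu1990, Lemma 1.9 (p. 28) (= Baker–Stark 1971, Lemma 3), p = 3] -/
theorem cube_descent (F : IntermediateField K L) (h3 : (3 : L) ≠ 0) {y : L} (hy3 : y ^ 3 ∈ F)
    (hnc : ∀ z ∈ F, z ^ 3 ≠ y ^ 3) {x : L} (hx : x ∈ F) {z : L} (hz : z ∈ F⟮y⟯)
    (hxz : x = z ^ 3) : ∃ k : ℕ, k < 3 ∧ ∃ γ ∈ F, x = (y ^ 3) ^ k * γ ^ 3 := by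
  obtain ⟨u, hu, v, hv, w, hw, rfl⟩ := exists_repr_of_mem_adjoin_simple F hy3 hz
  set c : L := y ^ 3 with hc
  have hcF : c ∈ F := hy3
  -- `z³ = A + B y + C y²`
  have hexp : (u + v * y + w * y ^ 2) ^ 3 =
      (u ^ 3 + 6 * u * v * w * c + v ^ 3 * c + w ^ 3 * c ^ 2) +
        (3 * (u ^ 2 * v + c * u * w ^ 2 + c * v ^ 2 * w)) * y +
        (3 * (u ^ 2 * w + u * v ^ 2 + c * v * w ^ 2)) * y ^ 2 := by
    rw [hc]; ring
  have hrel : ((u ^ 3 + 6 * u * v * w * c + v ^ 3 * c + w ^ 3 * c ^ 2) - x) +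
      (3 * (u ^ 2 * v + c * u * w ^ 2 + c * v ^ 2 * w)) * y +
      (3 * (u ^ 2 * w + u * v ^ 2 + c * v * w ^ 2)) * y ^ 2 = 0 := by
    rw [hxz, hexp]; ring
  have h3F : (3 : L) ∈ F := by
    have := IntermediateField.natCast_mem F 3
    exact_mod_cast this
  have h6F : (6 : L) ∈ F := by
    have := IntermediateField.natCast_mem F 6
    exact_mod_cast this
  obtain ⟨-, hB, hC⟩ := eq_zero_of_repr_eq_zero F hy3 hnc
    (sub_mem (add_mem (add_mem (add_mem (pow_mem hu 3)
      (mul_mem (mul_mem (mul_mem (mul_mem h6F hu) hv) hw) hcF)) (mul_mem (pow_mem hv 3) hcF))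
      (mul_mem (pow_mem hw 3) (pow_mem hcF 2))) hx)
    (mul_mem h3F (add_mem (add_mem (mul_mem (pow_mem hu 2) hv)
      (mul_mem (mul_mem hcF hu) (pow_mem hw 2))) (mul_mem (mul_mem hcF (pow_mem hv 2)) hw)))
    (mul_mem h3F (add_mem (add_mem (mul_mem (pow_mem hu 2) hw)
      (mul_mem hu (pow_mem hv 2))) (mul_mem (mul_mem hcF hv) (pow_mem hw 2))))
    hrel
  have hE1 : u ^ 2 * v + c * u * w ^ 2 + c * v ^ 2 * w = 0 := by
    rcases mul_eq_zero.mp hB with h | h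
    · exact absurd h h3
    · exact h
  have hE2 : u ^ 2 * w + u * v ^ 2 + c * v * w ^ 2 = 0 := by
    rcases mul_eq_zero.mp hC with h | h
    · exact absurd h h3
    · exact h
  have hkey : w * (c * v ^ 3 - u ^ 3) = 0 := by
    linear_combination v * hE1 - u * hE2
  rcases mul_eq_zero.mp hkey with hw0 | hcu
  · -- `w = 0`
    subst hw0
    have hE1' : u ^ 2 * v = 0 := by simpa using hE1
    rcases mul_eq_zero.mp hE1' with hu0 | hv0
    · have hu0' : u = 0 := pow_eq_zero_iff (two_ne_zero) |>.mp hu0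
      subst hu0'
      refine ⟨1, by norm_num, v, hv, ?_⟩
      rw [hxz, hc]; ring
    · subst hv0
      refine ⟨0, by norm_num, u, hu, ?_⟩
      rw [hxz]; ring
  · -- `c v³ = u³`: then `v = 0` (else `c` is a cube in `F`), so `u = 0`
    have hv0 : v = 0 := by
      by_contra hv0
      apply hnc (u / v) (div_mem hu hv)
      rw [div_pow, div_eq_iff (pow_ne_zero 3 hv0)]
      linear_combination -hcu
    subst hv0
    have hu0 : u = 0 := by
      have : u ^ 3 = 0 := by linear_combination -hcu
      exact pow_eq_zero_iff three_ne_zero |>.mp this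
    subst hu0
    refine ⟨2, by norm_num, w, hw, ?_⟩
    rw [hxz, hc]; ring

/-- **Extensions by cube roots with independent cube classes.** Let `y₀, y₁, … ∈ L` with
`yᵢ³ = cᵢ ∈ K` (`char ≠ 3`), and assume that no monomial `∏_{i<n} cᵢ^{kᵢ}` with some `kᵢ ≢ 0 (mod 3)`
is a cube in `K`. Then for every `m ≤ n`: `[K(y₀, …, y_{m-1}) : K] = 3^m`, and an `x ∈ K` which is
a cube in `K(y₀, …, y_{m-1})` becomes, after multiplication by a monomial in `c₀, …, c_{m-1}`, a
cube in `K`. (Induction on `m` by the pure cubic step and `cube_descent` = the `m`-fold iteration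
of the Baker–Stark lemma quoted by Yu, `p = 3`; no cube root of unity is needed.)
[cite: Yu1990, Lemma 1.9 (p. 28), iterated, p = 3] -/
theorem finrank_adjoin_image_cbrt_and_cube (h3 : (3 : L) ≠ 0) (y : ℕ → L) (c : ℕ → K)
    (hyc : ∀ i, algebraMap K L (c i) = y i ^ 3) (n : ℕ)
    (hind : ∀ k : ℕ → ℕ, (∃ i < n, ¬ 3 ∣ k i) →
      ∀ γ : K, ∏ i ∈ Finset.range n, c i ^ k i ≠ γ ^ 3) :
    ∀ m ≤ n, Module.finrank K ↥(adjoin K ((y '' {i | i < m}))) = 3 ^ m ∧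
      ∀ x : K, (∃ z ∈ adjoin K ((y '' {i | i < m})), algebraMap K L x = z ^ 3) →
        ∃ k : ℕ → ℕ, ∃ γ : K, x * ∏ i ∈ Finset.range m, c i ^ k i = γ ^ 3 := by
  intro m
  induction m with
  | zero =>
    intro _
    refine ⟨?_, ?_⟩
    · rw [Multiquadratic.image_lt_zero, adjoin_empty, IntermediateField.finrank_bot, pow_zero]
    · rintro x ⟨z, hz, hxz⟩
      rw [Multiquadratic.image_lt_zero, adjoin_empty, IntermediateField.mem_bot] at hz
      obtain ⟨w, rfl⟩ := hz
      refine ⟨fun _ => 0, w, ?_⟩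
      rw [Finset.range_zero, Finset.prod_empty, mul_one]
      apply (algebraMap K L).injective
      rw [hxz, map_pow]
  | succ m ih =>
    intro hm
    obtain ⟨ihrank, ihcube⟩ := ih (Nat.le_of_succ_le hm)
    set F : IntermediateField K L := adjoin K ((y '' {i | i < m})) with hF
    have hym3 : y m ^ 3 ∈ F := by rw [← hyc m]; exact IntermediateField.algebraMap_mem F (c m)
    -- `c m` is not a cube in `F`
    have hnc : ∀ z ∈ F, z ^ 3 ≠ y m ^ 3 := by
      intro z hz hzc
      obtain ⟨k, γ, hkγ⟩ := ihcube (c m) ⟨z, hz, by rw [hyc m, hzc]⟩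
      classical
      let k' : ℕ → ℕ := fun i => if i = m then 1 else if i < m then k i else 0
      refine hind k' ⟨m, Nat.lt_of_succ_le hm, by simp [k']⟩ γ ?_
      have hsub : Finset.range (m + 1) ⊆ Finset.range n := Finset.range_subset_range.mpr hm
      rw [← Finset.prod_subset hsub (fun i hi hi' => by
            have him : ¬ i < m + 1 := by simpa using hi'
            have h1 : i ≠ m := by omega
            have h2 : ¬ i < m := by omega
            simp [k', h1, h2]),
        Finset.prod_range_succ]
      have hkm : k' m = 1 := by simp [k']
      rw [hkm, pow_one, ← hkγ, mul_comm]
      congr 1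
      refine Finset.prod_congr rfl fun i hi => ?_
      have him : i < m := Finset.mem_range.mp hi
      have h1 : i ≠ m := by omega
      simp [k', h1, him]
    -- the new field as an extension of `F`
    set F' : IntermediateField K L := adjoin K ((y '' {i | i < m + 1})) with hF'
    have hle : F ≤ F' := by
      rw [hF, hF', Multiquadratic.image_lt_succ]
      exact adjoin.mono K _ _ (Set.subset_insert _ _)
    have hext : extendScalars hle = F⟮y m⟯ := by
      rw [extendScalars_adjoin hle]
      apply le_antisymm
      · rw [adjoin_le_iff, Multiquadratic.image_lt_succ]
        rintro z (rfl | ⟨i, hi, rfl⟩)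
        · exact mem_adjoin_simple_self F _
        · have hmem : y i ∈ F := subset_adjoin K _ (Set.mem_image_of_mem y hi)
          have : (algebraMap F L) ⟨y i, hmem⟩ ∈ F⟮y m⟯ := IntermediateField.algebraMap_mem _ _
          exact this
      · apply adjoin.mono
        rw [Multiquadratic.image_lt_succ]
        exact Set.singleton_subset_iff.mpr (Set.mem_insert _ _)
    refine ⟨?_, ?_⟩
    · -- degrees multiply
      have h1 := finrank_bot_mul_relfinrank hle
      rw [relfinrank_eq_finrank_of_le hle, hext, finrank_adjoin_simple_of_cube_mem F hym3 hnc,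
        ihrank] at h1
      rw [← h1, pow_succ]
    · rintro x ⟨z, hz, hxz⟩
      have hz' : z ∈ F⟮y m⟯ := by
        have : z ∈ extendScalars hle := (mem_extendScalars hle).mpr hz
        rwa [hext] at this
      have hxF : algebraMap K L x ∈ F := IntermediateField.algebraMap_mem F x
      obtain ⟨k₀, -, γ, hγ, hxγ⟩ := cube_descent F h3 hym3 hnc hxF hz' hxz
      -- `x · c_m^{2k₀} = ((y_m³)^{k₀} γ)³` with `(y_m³)^{k₀} γ ∈ F`
      have hmem : (y m ^ 3) ^ k₀ * γ ∈ F := mul_mem (pow_mem hym3 _) hγ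
      have heq : algebraMap K L (x * c m ^ (2 * k₀)) =
          ((y m ^ 3) ^ k₀ * γ) * ((y m ^ 3) ^ k₀ * γ) * ((y m ^ 3) ^ k₀ * γ) := by
        rw [map_mul, map_pow, hxγ, hyc m]; ring
      obtain ⟨k, γ', hk⟩ := ihcube (x * c m ^ (2 * k₀)) ⟨_, hmem, by rw [heq]; ring⟩
      classical
      refine ⟨fun i => if i = m then 2 * k₀ else k i, γ', ?_⟩
      beta_reduce
      rw [Finset.prod_range_succ, if_pos rfl, ← hk]
      have : ∏ i ∈ Finset.range m, c i ^ (if i = m then 2 * k₀ else k i) =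
          ∏ i ∈ Finset.range m, c i ^ k i := by
        refine Finset.prod_congr rfl fun i hi => ?_
        rw [if_neg (Finset.mem_range.mp hi).ne]
      rw [this]; ring

/-- **`Fin`-indexed form:** if `y₀, …, y_{n-1} ∈ L` satisfy `yⱼ³ = αⱼ ∈ K` (`char ≠ 3`) and no
monomial `∏ αⱼ^{kⱼ}` with some `kⱼ ≢ 0 (mod 3)` is a cube in `K`, then `[K(y₀, …, y_{n-1}) : K] = 3ⁿ`.
[cite: Yu1990, Lemma 1.9 (p. 28), iterated, p = 3] -/
theorem finrank_adjoin_eq_three_pow_of_cube_eq (h3 : (3 : L) ≠ 0) {n : ℕ} (α : Fin n → K)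
    (y : Fin n → L) (hy : ∀ j, y j ^ 3 = algebraMap K L (α j))
    (hind : ∀ k : Fin n → ℕ, (∃ j, ¬ 3 ∣ k j) → ∀ γ : K, ∏ j, α j ^ k j ≠ γ ^ 3) :
    Module.finrank K ↥(IntermediateField.adjoin K (Set.range y)) = 3 ^ n := by
  classical
  set c : ℕ → K := fun i => if h : i < n then α ⟨i, h⟩ else 0 with hc
  set y' : ℕ → L := fun i => if h : i < n then y ⟨i, h⟩ else 0 with hy'
  have hyc : ∀ i, algebraMap K L (c i) = y' i ^ 3 := by
    intro i
    by_cases h : i < n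
    · simp only [hc, hy', dif_pos h]; exact (hy _).symm
    · simp only [hc, hy', dif_neg h, map_zero]; norm_num
  have hrange : Set.range y = y' '' {i | i < n} := by
    ext z
    simp only [Set.mem_range, Set.mem_image, Set.mem_setOf_eq]
    constructor
    · rintro ⟨j, rfl⟩
      exact ⟨j, j.2, by simp [hy', j.2]⟩
    · rintro ⟨i, hi, rfl⟩
      exact ⟨⟨i, hi⟩, by simp [hy', hi]⟩
  have hind' : ∀ k : ℕ → ℕ, (∃ i < n, ¬ 3 ∣ k i) →
      ∀ γ : K, ∏ i ∈ Finset.range n, c i ^ k i ≠ γ ^ 3 := by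
    rintro k ⟨i, hi, hki⟩ γ hγ
    refine hind (fun j => k j) ⟨⟨i, hi⟩, hki⟩ γ ?_
    rw [← hγ, ← Fin.prod_univ_eq_prod_range (fun i => c i ^ k i) n]
    refine Finset.prod_congr rfl fun j _ => ?_
    simp [hc, j.2]
  rw [hrange]
  exact (finrank_adjoin_image_cbrt_and_cube h3 y' c hyc n hind' n le_rfl).1

end Multicubic

/-! ### The field `ℚ(ζ₆)`: norms, cube classes, and the absence of `ζ₉` -/

namespace ZetaSix

variable {K : Type*} [Field K] [Algebra ℚ K]

omit [Algebra ℚ K] in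
/-- A primitive sixth root of unity `ζ` (`ζ² − ζ + 1 = 0`) has `ζ³ = −1`. [folklore] -/
private theorem zeta_pow_three {ζ : K} (hζ : ζ * ζ - ζ + 1 = 0) : ζ ^ 3 = -1 := by
  linear_combination (ζ + 1) * hζ

omit [Algebra ℚ K] in
/-- … and `ζ⁶ = 1`. [folklore] -/
private theorem zeta_pow_six {ζ : K} (hζ : ζ * ζ - ζ + 1 = 0) : ζ ^ 6 = 1 := by
  calc ζ ^ 6 = (ζ ^ 3) ^ 2 := by ring
    _ = 1 := by rw [zeta_pow_three hζ]; norm_num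

/-- A rational sixth root of unity is `±1`. [folklore] -/
private theorem rat_pow_six_eq_one {x : ℚ} (h : x ^ 6 = 1) : x = 1 ∨ x = -1 := by
  have habs : |x| ^ 6 = 1 := by rw [← abs_pow, h, abs_one]
  have h1 : |x| = 1 := (pow_eq_one_iff_of_nonneg (abs_nonneg x) (by norm_num)).mp habs
  exact abs_eq zero_le_one |>.mp h1

/-- The norm of a primitive sixth root of unity of `K ⊇ ℚ` is `±1`. [folklore] -/
private theorem norm_zeta {ζ : K} (hζ : ζ * ζ - ζ + 1 = 0) :
    Algebra.norm ℚ ζ = 1 ∨ Algebra.norm ℚ ζ = -1 := by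
  apply rat_pow_six_eq_one
  rw [← map_pow, zeta_pow_six hζ, map_one]

/-- **No ninth root of unity in a quadratic field:** if `[K : ℚ] = 2`, no `θ ∈ K` satisfies
`θ⁶ + θ³ + 1 = 0` (`Φ₉` is irreducible of degree `6 > 2`). [folklore] -/
private theorem cyclotomic_nine_no_root (hK : Module.finrank ℚ K = 2) (θ : K) :
    θ ^ 6 + θ ^ 3 + 1 ≠ 0 := by
  intro hθ
  have : Module.Finite ℚ K := Module.finite_of_finrank_pos (by omega)
  have h9 : cyclotomic 9 ℚ = X ^ 6 + X ^ 3 + 1 := by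
    have h := cyclotomic_prime_pow_eq_geom_sum (R := ℚ) (p := 3) (n := 1) Nat.prime_three
    norm_num [Finset.sum_range_succ] at h
    rw [h]; ring
  have hirr : Irreducible (cyclotomic 9 ℚ) := cyclotomic.irreducible_rat (by norm_num)
  have hroot : aeval θ (cyclotomic 9 ℚ) = 0 := by
    rw [h9]; simp only [map_add, map_pow, aeval_X, map_one]; exact hθ
  have hmin := minpoly.eq_of_irreducible_of_monic hirr hroot (cyclotomic.monic 9 ℚ)
  have hdeg := minpoly.natDegree_le θ (A := ℚ)
  rw [← hmin, h9, hK] at hdeg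
  have h6 : (X ^ 6 + X ^ 3 + 1 : ℚ[X]).natDegree = 6 := by compute_degree!
  omega

/-- **`ζ₆^k` is a cube in `ℚ(ζ₆)` only if `3 ∣ k`:** otherwise a cube root `δ` of `±ζ₆^{±1}` would
be a primitive `9`-th or `18`-th root of unity in a quadratic field. [folklore] -/
private theorem three_dvd_of_zeta_pow_eq_cube (hK : Module.finrank ℚ K = 2) {ζ : K}
    (hζ : ζ * ζ - ζ + 1 = 0) {k : ℕ} {δ : K} (h : ζ ^ k = δ ^ 3) : 3 ∣ k := by
  by_contra hk
  have h3 := zeta_pow_three hζ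
  -- `ζ^k = (-1)^q ζ^r`, `k = 3q + r`, `r ∈ {1, 2}`
  obtain ⟨q, r, hr, rfl⟩ : ∃ q r : ℕ, (r = 1 ∨ r = 2) ∧ k = 3 * q + r :=
    ⟨k / 3, k % 3, by omega, by omega⟩
  have hk' : ζ ^ (3 * q + r) = (-1) ^ q * ζ ^ r := by
    rw [pow_add, pow_mul, h3]
  set ε : K := (-1) ^ q with hε
  have hε2 : ε * ε = 1 := by rw [hε, ← mul_pow]; norm_num
  -- `δ' = ε δ` has `δ'³ = ζ^r`
  have hδ' : (ε * δ) ^ 3 = ζ ^ r := by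
    have : ε ^ 3 = ε := by
      calc ε ^ 3 = (ε * ε) * ε := by ring
        _ = ε := by rw [hε2, one_mul]
    rw [mul_pow, this, ← h, hk']
    calc ε * (ε * ζ ^ r) = (ε * ε) * ζ ^ r := by ring
      _ = ζ ^ r := by rw [hε2, one_mul]
  rcases hr with rfl | rfl
  · -- `δ'³ = ζ`: `θ = -δ'` is a root of `Φ₉`
    apply cyclotomic_nine_no_root hK (-(ε * δ))
    have h6 : (-(ε * δ)) ^ 6 = ζ ^ 2 := by
      calc (-(ε * δ)) ^ 6 = ((ε * δ) ^ 3) ^ 2 := by ring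
        _ = ζ ^ 2 := by rw [hδ', pow_one]
    have h3' : (-(ε * δ)) ^ 3 = -ζ := by
      calc (-(ε * δ)) ^ 3 = -((ε * δ) ^ 3) := by ring
        _ = -ζ := by rw [hδ', pow_one]
    rw [h6, h3']
    linear_combination hζ
  · -- `δ'³ = ζ² = ζ - 1`: `θ = δ'` is a root of `Φ₉`
    apply cyclotomic_nine_no_root hK (ε * δ)
    have h6 : (ε * δ) ^ 6 = (ζ ^ 2) ^ 2 := by
      calc (ε * δ) ^ 6 = ((ε * δ) ^ 3) ^ 2 := by ring
        _ = (ζ ^ 2) ^ 2 := by rw [hδ']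
    rw [h6, hδ']
    linear_combination (ζ ^ 2 + ζ + 1) * hζ

/-- **Independent cube classes in `ℚ(ζ₆)`: `ζ₆` and distinct primes.** If `[K : ℚ] = 2`, `ζ ∈ K`
with `ζ² − ζ + 1 = 0`, and `p₁, …, pₙ` are distinct primes, then no monomial
`ζ^{k₀} p₁^{k₁} ⋯ pₙ^{kₙ}` with some `kⱼ ≢ 0 (mod 3)` is a cube in `K` (norm to `ℚ`: the norm of a
cube is a cube, `N(ζ) = ±1`, `N(pⱼ) = pⱼ²`, and `2kⱼ ≡ 0 (mod 3)` forces `3 ∣ kⱼ`; the remaining case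
is `three_dvd_of_zeta_pow_eq_cube`). Kummer condition (2.15) of Yu 1990 for `K = ℚ(ζ₆)`, `q = 3`,
`α₀ = ζ₆`, in independence form. [cite: StewartYu1991, Lemma 3 (p. 227)] -/
theorem not_cube_prod_zeta6_primes (hK : Module.finrank ℚ K = 2) {ζ : K}
    (hζ : ζ * ζ - ζ + 1 = 0) {n : ℕ} (pr : Fin n → ℕ) (hpr : ∀ j, (pr j).Prime)
    (hinj : Function.Injective pr) (k : Fin (n + 1) → ℕ) (hk : ∃ j, ¬ 3 ∣ k j) (γ : K) :
    ∏ j, (Fin.cons ζ (fun j => (pr j : K)) : Fin (n + 1) → K) j ^ k j ≠ γ ^ 3 := by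
  classical
  intro h
  rw [Fin.prod_univ_succ] at h
  simp only [Fin.cons_zero, Fin.cons_succ] at h
  set R : ℚ := ∏ j : Fin n, (pr j : ℚ) ^ k j.succ with hR
  have hRK : ∏ j : Fin n, (pr j : K) ^ k j.succ = algebraMap ℚ K R := by
    rw [hR, map_prod]
    simp_rw [map_pow, map_natCast]
  rw [hRK] at h
  have hpr0 : ∀ j, (pr j : ℚ) ≠ 0 := fun j => by exact_mod_cast (hpr j).ne_zero
  have hR0 : R ≠ 0 := Finset.prod_ne_zero_iff.mpr fun j _ => pow_ne_zero _ (hpr0 j)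
  have hζ0 : ζ ≠ 0 := by
    intro h0; rw [h0] at hζ; norm_num at hζ
  by_cases hcase : ∃ j₀ : Fin n, ¬ 3 ∣ k j₀.succ
  · -- an odd exponent at a prime: take norms and the valuation at that prime
    obtain ⟨j₀, hj₀⟩ := hcase
    haveI : Fact (pr j₀).Prime := ⟨hpr j₀⟩
    have hN := congrArg (Algebra.norm ℚ) h
    rw [map_mul, map_pow, map_pow, Algebra.norm_algebraMap, hK] at hN
    -- valuation of `R` at `p_{j₀}` is `k_{j₀}`
    have hvR : padicValRat (pr j₀) R = k j₀.succ := by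
      rw [hR, Literature.NumberTheory.DiophantineGeometry.Dioph.padicValRat_finset_prod (pr j₀) _ _
        fun j _ => pow_ne_zero _ (hpr0 j)]
      have hval : ∀ j, padicValRat (pr j₀) ((pr j : ℚ) ^ k j.succ) =
          if j = j₀ then (k j₀.succ : ℤ) else 0 := by
        intro j
        rw [padicValRat.pow, padicValRat.of_nat]
        by_cases hj : j = j₀
        · subst hj; simp [padicValNat_self]
        · haveI : Fact (pr j).Prime := ⟨hpr j⟩
          rw [if_neg hj, padicValNat_primes (fun h => hj (hinj h).symm)]; simp
      simp only [hval, Finset.sum_ite_eq', Finset.mem_univ, if_true]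
    have hNγ0 : Algebra.norm ℚ γ ≠ 0 := by
      intro h0
      rw [h0, zero_pow three_ne_zero] at hN
      rcases norm_zeta hζ with h1 | h1 <;> rw [h1] at hN <;> simp [hR0] at hN
    have hv := congrArg (padicValRat (pr j₀)) hN
    have hs : padicValRat (pr j₀) (Algebra.norm ℚ ζ ^ k 0) = 0 := by
      rcases norm_zeta hζ with h1 | h1
      · rw [h1, one_pow, padicValRat.one]
      · rw [h1, padicValRat.pow, padicValRat.neg, padicValRat.one, mul_zero]
    have hsne : Algebra.norm ℚ ζ ^ k 0 ≠ 0 := by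
      rcases norm_zeta hζ with h1 | h1 <;> rw [h1] <;> simp
    rw [padicValRat.mul hsne (pow_ne_zero 2 hR0), hs, zero_add, padicValRat.pow, hvR,
      padicValRat.pow] at hv
    push_cast at hv
    apply hj₀
    have : (3 : ℤ) ∣ 2 * (k j₀.succ : ℤ) := ⟨padicValRat (pr j₀) (Algebra.norm ℚ γ), by linarith⟩
    omega
  · -- all prime exponents divisible by `3`: then `ζ^{k₀}` is a cube, so `3 ∣ k₀`
    push Not at hcase
    have hk0 : ¬ 3 ∣ k 0 := by
      obtain ⟨j, hj⟩ := hk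
      refine Fin.cases ?_ (fun i hi => absurd (hcase i) hi) j hj
      exact id
    apply hk0
    -- `R = S³`
    set S : ℚ := ∏ j : Fin n, (pr j : ℚ) ^ (k j.succ / 3) with hS
    have hRS : R = S ^ 3 := by
      rw [hS, ← Finset.prod_pow]
      refine Finset.prod_congr rfl fun j _ => ?_
      rw [← pow_mul, Nat.div_mul_cancel (hcase j)]
    have hS0 : S ≠ 0 := Finset.prod_ne_zero_iff.mpr fun j _ => pow_ne_zero _ (hpr0 j)
    have hSK : algebraMap ℚ K S ≠ 0 := by
      rw [ne_eq, map_eq_zero_iff _ (algebraMap ℚ K).injective]; exact hS0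
    refine three_dvd_of_zeta_pow_eq_cube hK hζ (δ := γ / algebraMap ℚ K S) ?_
    rw [div_pow, eq_div_iff (pow_ne_zero 3 hSK), ← h, hRS, map_pow]

end ZetaSix

/-! ### Stewart–Yu 1991, Lemma 3, the case `q = 3`, `K = ℚ(ζ₆)` -/

section LemmaThreeZetaSix

variable {K : Type*} [Field K] [Algebra ℚ K] {L : Type*} [Field L] [Algebra K L]

/-- `3 ≠ 0` in a field extension of a `ℚ`-algebra field. [folklore] -/
private theorem three_ne_zero_of_algebra_rat (K₀ : Type*) {L₀ : Type*} [Field K₀] [Algebra ℚ K₀]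
    [Field L₀] [Algebra K₀ L₀] : (3 : L₀) ≠ 0 := by
  haveI : CharZero K₀ := charZero_of_injective_algebraMap (algebraMap ℚ K₀).injective
  rw [show (3 : L₀) = algebraMap K₀ L₀ 3 from (map_ofNat (algebraMap K₀ L₀) 3).symm]
  exact (_root_.map_ne_zero _).mpr three_ne_zero

/-- **Stewart–Yu 1991, Lemma 3 (case `q = 3`, `α₀ = ζ₆`).** Let `K = ℚ(ζ₆)` (any field with
`[K : ℚ] = 2` and `ζ ∈ K`, `ζ² − ζ + 1 = 0`) and let `α₁ < ⋯ < αₙ` be primes (here: distinct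
primes). Then for any cube roots `y₀` of `ζ₆` and `yⱼ` of `αⱼ` in an extension `L ⊇ K`:
`[K(α₀^{1/3}, α₁^{1/3}, …, αₙ^{1/3}) : K] = 3^{n+1}` (printed: "Let … `q = 3` and `α₀ = ζ₆` and put
`K = ℚ(α₀)`. Then `[K(α₀^{1/q}, α₁^{1/q}, …, αₙ^{1/q}) : K] = q^{n+1}`"; used for `p = 2`, p. 228).
Proof by the cube descent (`Multicubic`) from the cube-class independence
`ZetaSix.not_cube_prod_zeta6_primes` (norms to `ℚ`). [cite: StewartYu1991, Lemma 3 (p. 227)] -/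
theorem finrank_adjoin_cbrt_zeta6_primes (hK : Module.finrank ℚ K = 2) {ζ : K}
    (hζ : ζ * ζ - ζ + 1 = 0) {n : ℕ} (pr : Fin n → ℕ) (hpr : ∀ j, (pr j).Prime)
    (hinj : Function.Injective pr) (y : Fin (n + 1) → L)
    (hy : ∀ j, y j ^ 3 = algebraMap K L ((Fin.cons ζ (fun j => (pr j : K)) : Fin (n + 1) → K) j)) :
    Module.finrank K ↥(IntermediateField.adjoin K (Set.range y)) = 3 ^ (n + 1) :=
  Multicubic.finrank_adjoin_eq_three_pow_of_cube_eq (three_ne_zero_of_algebra_rat K) _ y hy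
    fun k hk γ => ZetaSix.not_cube_prod_zeta6_primes hK hζ pr hpr hinj k hk γ

/-- **Stewart–Yu 1991, Lemma 3 (`q = 3`) in the model `K = ℚ(ζ₆) ⊂ L`:** for a field `L ⊇ ℚ`
containing `ζ` with `ζ² − ζ + 1 = 0`, distinct primes `p₁, …, pₙ`, and cube roots `y₀³ = ζ`,
`yⱼ³ = pⱼ` in `L`: `[ℚ(ζ)(y₀, …, yₙ) : ℚ(ζ)] = 3^{n+1}` — hypothesis-free form of
`finrank_adjoin_cbrt_zeta6_primes` (`[ℚ(ζ₆) : ℚ] = 2` by `X² − X + 1`).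
[cite: StewartYu1991, Lemma 3 (p. 227)] -/
theorem finrank_adjoin_cbrt_zeta6_primes_model {L : Type*} [Field L] [Algebra ℚ L] {ζ : L}
    (hζ : ζ * ζ - ζ + 1 = 0) {n : ℕ} (pr : Fin n → ℕ) (hpr : ∀ j, (pr j).Prime)
    (hinj : Function.Injective pr) (y : Fin (n + 1) → L)
    (hy : ∀ j, y j ^ 3 = (Fin.cons ζ (fun j => (pr j : L)) : Fin (n + 1) → L) j) :
    Module.finrank ↥ℚ⟮ζ⟯ ↥(IntermediateField.adjoin ↥ℚ⟮ζ⟯ (Set.range y)) = 3 ^ (n + 1) := by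
  have hK : Module.finrank ℚ ↥ℚ⟮ζ⟯ = 2 :=
    finrank_adjoin_simple_eq_two_of_quadratic (a := -1) (b := 1)
      (by rw [map_neg, map_one, neg_mul, one_mul, ← sub_eq_add_neg, hζ]) (by norm_num)
  have hζK : (⟨ζ, mem_adjoin_simple_self ℚ ζ⟩ : ↥ℚ⟮ζ⟯) * ⟨ζ, mem_adjoin_simple_self ℚ ζ⟩ -
      ⟨ζ, mem_adjoin_simple_self ℚ ζ⟩ + 1 = 0 :=
    Subtype.ext (by simpa using hζ)
  exact finrank_adjoin_cbrt_zeta6_primes (by convert hK; exact Subsingleton.elim _ _) hζK pr hpr hinj y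
    fun j => by rw [hy j, algebraMap_cons_adjoin]

end LemmaThreeZetaSix

/-! ### Monomial bases: the Kummer condition in the form the descent uses -/

namespace Multiquadratic

variable {K L : Type*} [Field K] [Field L] [Algebra K L]

/-- Products of square-root monomials in any field: for `yⱼ² = αⱼ`,
`(∏_{S} yⱼ)(∏_{T} yⱼ) = (∏_{S ∩ T} αⱼ) · ∏_{S Δ T} yⱼ`. [folklore] -/
private theorem prod_mul_prod_of_mul_self_eq {n : ℕ} (α : Fin n → K) (y : Fin n → L)
    (hy : ∀ j, y j * y j = algebraMap K L (α j)) (S T : Finset (Fin n)) :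
    (∏ j ∈ S, y j) * (∏ j ∈ T, y j) =
      algebraMap K L (∏ j ∈ S ∩ T, α j) * ∏ j ∈ symmDiff S T, y j := by
  classical
  have hS : ∏ j ∈ S, y j = (∏ j ∈ S \ T, y j) * ∏ j ∈ S ∩ T, y j := by
    rw [← Finset.prod_union (Finset.disjoint_sdiff_inter S T), Finset.sdiff_union_inter]
  have hT : ∏ j ∈ T, y j = (∏ j ∈ T \ S, y j) * ∏ j ∈ S ∩ T, y j := by
    rw [Finset.inter_comm, ← Finset.prod_union (Finset.disjoint_sdiff_inter T S),
      Finset.sdiff_union_inter]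
  have hsq : (∏ j ∈ S ∩ T, y j) * (∏ j ∈ S ∩ T, y j) = algebraMap K L (∏ j ∈ S ∩ T, α j) := by
    rw [← Finset.prod_mul_distrib, map_prod]
    exact Finset.prod_congr rfl fun j _ => hy j
  have hΔ : ∏ j ∈ symmDiff S T, y j = (∏ j ∈ S \ T, y j) * ∏ j ∈ T \ S, y j := by
    rw [symmDiff_def, Finset.sup_eq_union, Finset.prod_union disjoint_sdiff_sdiff]
  rw [hS, hT, hΔ, ← hsq]; ring

/-- **The square-root monomials are linearly independent over the base field** when the square
classes are independent (`char ≠ 2`): for `yⱼ² = αⱼ ∈ K` with no non-empty sub-product of the `αⱼ`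
a square in `K`, the `2ⁿ` products `∏_{j ∈ S} yⱼ`, `S ⊆ {0, …, n-1}`, are linearly independent over
`K` in `L` (they span `K(y₀, …, y_{n-1})`, of degree `2ⁿ`). Base-field/arbitrary-`L` form of the
tree's `linearIndependent_prod_sqrt` (there `K = ℚ`, `L = ℝ`); this is how the Kummer condition
enters the `q`-descent ("the `qⁿ` elements `∏ (αⱼ^{1/q})^{p^κ s λⱼ*}`, `0 ≤ λⱼ* < q`, are linearly
independent over `K(ξ^{G₁})`"). [cite: Yu1990, (2.110) (p. 59); Lemma 1.9 (p. 28)] -/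
theorem linearIndependent_prod_of_mul_self_eq_base (h2 : (2 : L) ≠ 0) {n : ℕ} (α : Fin n → K)
    (y : Fin n → L) (hy : ∀ j, y j * y j = algebraMap K L (α j))
    (hind : ∀ T : Finset (Fin n), T.Nonempty → ¬ IsSquare (∏ j ∈ T, α j)) :
    LinearIndependent K (fun S : Finset (Fin n) => ∏ j ∈ S, y j) := by
  classical
  set v : Finset (Fin n) → L := fun S => ∏ j ∈ S, y j with hv
  set E : IntermediateField K L := IntermediateField.adjoin K (Set.range y) with hE
  have hfin : Module.finrank K ↥E = 2 ^ n :=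
    finrank_adjoin_eq_two_pow_of_mul_self_eq_base h2 α y hy hind
  set V : Submodule K L := Submodule.span K (Set.range v) with hV
  -- `V` is closed under multiplication and contains `1`
  have hVmul : ∀ x z, x ∈ V → z ∈ V → x * z ∈ V := by
    intro x z hx hz
    have hxz : x * z ∈ V * V := Submodule.mul_mem_mul hx hz
    rw [hV, Submodule.span_mul_span] at hxz
    refine (Submodule.span_le.mpr ?_) hxz
    rintro _ ⟨a, ⟨S, rfl⟩, b, ⟨T, rfl⟩, rfl⟩
    show v S * v T ∈ Submodule.span K (Set.range v)
    have hprod : v S * v T = (∏ j ∈ S ∩ T, α j) • v (symmDiff S T) := by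
      rw [Algebra.smul_def]
      exact prod_mul_prod_of_mul_self_eq α y hy S T
    rw [hprod]
    exact Submodule.smul_mem _ _ (Submodule.subset_span ⟨symmDiff S T, rfl⟩)
  have h1 : (1 : L) ∈ V := Submodule.subset_span ⟨∅, by simp [hv]⟩
  set A : Subalgebra K L := V.toSubalgebra h1 hVmul with hA
  have halg : ∀ x ∈ Set.range y, IsAlgebraic K x := by
    rintro _ ⟨j, rfl⟩
    have hint : IsIntegral K (y j ^ 2) := by
      rw [sq, hy j]; exact isIntegral_algebraMap
    exact (hint.of_pow two_pos).isAlgebraic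
  have hEA : E.toSubalgebra ≤ A := by
    rw [hE, IntermediateField.adjoin_toSubalgebra_of_isAlgebraic halg]
    refine Algebra.adjoin_le ?_
    rintro _ ⟨j, rfl⟩
    show y j ∈ V
    exact Submodule.subset_span ⟨{j}, by simp [hv]⟩
  have hVE : V = Subalgebra.toSubmodule E.toSubalgebra := by
    apply le_antisymm
    · rw [hV, Submodule.span_le]
      rintro _ ⟨S, rfl⟩
      show v S ∈ E
      exact prod_mem fun j _ => IntermediateField.subset_adjoin K _ ⟨j, rfl⟩
    · intro x hx; exact hEA hx
  rw [linearIndependent_iff_card_eq_finrank_span, Fintype.card_finset, Fintype.card_fin]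
  show 2 ^ n = Module.finrank K ↥(Submodule.span K (Set.range v))
  rw [← hV, hVE, Subalgebra.finrank_toSubmodule]
  exact hfin.symm

end Multiquadratic

namespace Multicubic

variable {K L : Type*} [Field K] [Field L] [Algebra K L]

/-- Products of cube-root monomials: for `yⱼ³ = αⱼ` and exponent vectors `λ, μ ∈ {0,1,2}ⁿ`,
`(∏ yⱼ^{λⱼ})(∏ yⱼ^{μⱼ}) = (∏ αⱼ^{⌊(λⱼ+μⱼ)/3⌋}) · ∏ yⱼ^{(λⱼ+μⱼ) mod 3}`. [folklore] -/
private theorem prod_pow_mul_prod_pow_of_cube_eq {n : ℕ} (α : Fin n → K) (y : Fin n → L)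
    (hy : ∀ j, y j ^ 3 = algebraMap K L (α j)) (l m : Fin n → Fin 3) :
    (∏ j, y j ^ (l j : ℕ)) * (∏ j, y j ^ (m j : ℕ)) =
      algebraMap K L (∏ j, α j ^ (((l j : ℕ) + m j) / 3)) *
        ∏ j, y j ^ ((fun j => (⟨((l j : ℕ) + m j) % 3, Nat.mod_lt _ (by norm_num)⟩ : Fin 3)) j : ℕ) := by
  rw [map_prod, ← Finset.prod_mul_distrib, ← Finset.prod_mul_distrib]
  refine Finset.prod_congr rfl fun j _ => ?_
  rw [map_pow, ← hy j, ← pow_mul, ← pow_add, ← pow_add]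
  congr 1
  simp only
  omega

/-- **The cube-root monomials are linearly independent over the base field** when the cube classes
are independent (`char ≠ 3`): for `yⱼ³ = αⱼ ∈ K` such that no monomial `∏ αⱼ^{kⱼ}` with some
`3 ∤ kⱼ` is a cube in `K`, the `3ⁿ` monomials `∏ yⱼ^{λⱼ}`, `λ ∈ {0,1,2}ⁿ`, are linearly independent
over `K` in `L` (they span `K(y₀, …, y_{n-1})`, of degree `3ⁿ` by
`finrank_adjoin_eq_three_pow_of_cube_eq`). This is the form in which the Kummer condition (2.15)
enters Yu's `q`-descent for `q = 3` ("the `qⁿ` elements `∏ (αⱼ^{1/q})^{p^κ s λⱼ*}`, `0 ≤ λⱼ* < q`,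
are linearly independent over `K(ξ^{G₁})`"). [cite: Yu1990, (2.110) (p. 59); Lemma 1.9 (p. 28)] -/
theorem linearIndependent_prod_pow_of_cube_eq (h3 : (3 : L) ≠ 0) {n : ℕ} (α : Fin n → K)
    (y : Fin n → L) (hy : ∀ j, y j ^ 3 = algebraMap K L (α j))
    (hind : ∀ k : Fin n → ℕ, (∃ j, ¬ 3 ∣ k j) → ∀ γ : K, ∏ j, α j ^ k j ≠ γ ^ 3) :
    LinearIndependent K (fun l : Fin n → Fin 3 => ∏ j, y j ^ (l j : ℕ)) := by
  classical
  set v : (Fin n → Fin 3) → L := fun l => ∏ j, y j ^ (l j : ℕ) with hv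
  set E : IntermediateField K L := IntermediateField.adjoin K (Set.range y) with hE
  have hfin : Module.finrank K ↥E = 3 ^ n :=
    finrank_adjoin_eq_three_pow_of_cube_eq h3 α y hy hind
  set V : Submodule K L := Submodule.span K (Set.range v) with hV
  have hVmul : ∀ x z, x ∈ V → z ∈ V → x * z ∈ V := by
    intro x z hx hz
    have hxz : x * z ∈ V * V := Submodule.mul_mem_mul hx hz
    rw [hV, Submodule.span_mul_span] at hxz
    refine (Submodule.span_le.mpr ?_) hxz
    rintro _ ⟨a, ⟨l, rfl⟩, b, ⟨m, rfl⟩, rfl⟩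
    show v l * v m ∈ Submodule.span K (Set.range v)
    have hprod : v l * v m = (∏ j, α j ^ (((l j : ℕ) + m j) / 3)) •
        v (fun j => (⟨((l j : ℕ) + m j) % 3, Nat.mod_lt _ (by norm_num)⟩ : Fin 3)) := by
      rw [Algebra.smul_def]
      exact prod_pow_mul_prod_pow_of_cube_eq α y hy l m
    rw [hprod]
    exact Submodule.smul_mem _ _ (Submodule.subset_span (Set.mem_range_self _))
  have h1 : (1 : L) ∈ V := Submodule.subset_span ⟨fun _ => 0, by simp [hv]⟩
  set A : Subalgebra K L := V.toSubalgebra h1 hVmul with hA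
  have halg : ∀ x ∈ Set.range y, IsAlgebraic K x := by
    rintro _ ⟨j, rfl⟩
    have hint : IsIntegral K (y j ^ 3) := by
      rw [hy j]; exact isIntegral_algebraMap
    exact (hint.of_pow (by norm_num)).isAlgebraic
  have hEA : E.toSubalgebra ≤ A := by
    rw [hE, IntermediateField.adjoin_toSubalgebra_of_isAlgebraic halg]
    refine Algebra.adjoin_le ?_
    rintro _ ⟨j, rfl⟩
    show y j ∈ V
    refine Submodule.subset_span ⟨fun i => if i = j then 1 else 0, ?_⟩
    show ∏ i, y i ^ ((if i = j then (1 : Fin 3) else 0 : Fin 3) : ℕ) = y j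
    rw [Finset.prod_eq_single j (fun i _ hi => by rw [if_neg hi]; simp) (fun h => absurd (Finset.mem_univ j) h)]
    simp
  have hVE : V = Subalgebra.toSubmodule E.toSubalgebra := by
    apply le_antisymm
    · rw [hV, Submodule.span_le]
      rintro _ ⟨l, rfl⟩
      show v l ∈ E
      exact prod_mem fun j _ => pow_mem (IntermediateField.subset_adjoin K _ (Set.mem_range_self j)) _
    · intro x hx; exact hEA hx
  rw [linearIndependent_iff_card_eq_finrank_span, Fintype.card_fun, Fintype.card_fin,
    Fintype.card_fin]
  show 3 ^ n = Module.finrank K ↥(Submodule.span K (Set.range v))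
  rw [← hV, hVE, Subalgebra.finrank_toSubmodule]
  exact hfin.symm

end Multicubic

/-! ### Cube classes of distinct primes over `ℚ` (the `q = 3` descent over `K = ℚ` at `p = 2`) -/

section CubeClassesRat

/-- The valuation at `p_{j₀}` of a monomial in distinct primes is its exponent at `j₀`.
[folklore] -/
private theorem padicValRat_prod_pow_primes {n : ℕ} (pr : Fin n → ℕ) (hpr : ∀ j, (pr j).Prime)
    (hinj : Function.Injective pr) (k : Fin n → ℕ) (j₀ : Fin n) :
    padicValRat (pr j₀) (∏ j, (pr j : ℚ) ^ k j) = k j₀ := by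
  classical
  haveI : Fact (pr j₀).Prime := ⟨hpr j₀⟩
  have hpr0 : ∀ j, (pr j : ℚ) ≠ 0 := fun j => by exact_mod_cast (hpr j).ne_zero
  rw [Literature.NumberTheory.DiophantineGeometry.Dioph.padicValRat_finset_prod (pr j₀) _ _
    fun j _ => pow_ne_zero _ (hpr0 j)]
  have hval : ∀ j, padicValRat (pr j₀) ((pr j : ℚ) ^ k j) = if j = j₀ then (k j₀ : ℤ) else 0 := by
    intro j
    rw [padicValRat.pow, padicValRat.of_nat]
    by_cases hj : j = j₀
    · subst hj; simp [padicValNat_self]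
    · haveI : Fact (pr j).Prime := ⟨hpr j⟩
      rw [if_neg hj, padicValNat_primes (fun h => hj (hinj h).symm)]; simp
  simp only [hval, Finset.sum_ite_eq', Finset.mem_univ, if_true]

/-- **Cube classes of distinct primes are independent in `ℚ`:** for distinct primes `p₁, …, pₙ`
and exponents `kⱼ` not all divisible by `3`, `∏ pⱼ^{kⱼ}` is not the cube of a rational number
(valuation at a `pⱼ` with `3 ∤ kⱼ`). This is the case `q = 3` of Stewart–Yu 1991, Lemma 3,
restricted from `K = ℚ(ζ₆)` to `ℚ` and put in the independence form a Kummer descent consumes (it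
is also immediate from `ZetaSix.not_cube_prod_zeta6_primes`).
[cite: StewartYu1991, Lemma 3 (p. 227), case q = 3, over ℚ] -/
theorem not_cube_prod_pow_primes_rat {n : ℕ} (pr : Fin n → ℕ) (hpr : ∀ j, (pr j).Prime)
    (hinj : Function.Injective pr) (k : Fin n → ℕ) (hk : ∃ j, ¬ 3 ∣ k j) (y : ℚ) :
    y ^ 3 ≠ ∏ j, (pr j : ℚ) ^ k j := by
  obtain ⟨j₀, hj₀⟩ := hk
  intro h
  haveI : Fact (pr j₀).Prime := ⟨hpr j₀⟩
  have hv := congrArg (padicValRat (pr j₀)) h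
  rw [padicValRat_prod_pow_primes pr hpr hinj k j₀, padicValRat.pow] at hv
  have h3 : ((3 : ℕ) : ℤ) ∣ ((k j₀ : ℕ) : ℤ) := ⟨padicValRat (pr j₀) y, by push_cast at hv ⊢; linarith⟩
  exact hj₀ (Int.natCast_dvd_natCast.mp h3)

/-- **Cube classes of squares of distinct primes are independent in `ℚ`:** for distinct primes
`p₁, …, pₙ` and exponents `kⱼ` not all divisible by `3`, `∏ (pⱼ²)^{kⱼ}` is not a rational cube
(exponents `2kⱼ`, and `3 ∣ 2kⱼ ⇒ 3 ∣ kⱼ`) — the generators `αⱼ = qⱼ² ≡ 1 (mod 8)` of the `2`-adic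
`q = 3` descent over `ℚ`. [cite: StewartYu1991, Lemma 3 (p. 227), case q = 3, over ℚ] -/
theorem not_cube_prod_pow_primes_sq_rat {n : ℕ} (pr : Fin n → ℕ) (hpr : ∀ j, (pr j).Prime)
    (hinj : Function.Injective pr) (k : Fin n → ℕ) (hk : ∃ j, ¬ 3 ∣ k j) (y : ℚ) :
    y ^ 3 ≠ ∏ j, ((pr j : ℚ) ^ 2) ^ k j := by
  obtain ⟨j₀, hj₀⟩ := hk
  have h := not_cube_prod_pow_primes_rat pr hpr hinj (fun j => 2 * k j) ⟨j₀, by omega⟩ y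
  simpa only [pow_mul] using h

/-- **`[ℚ(p₁^{1/3}, …, pₙ^{1/3}) : ℚ] = 3ⁿ` for distinct primes**, cube roots taken in any field
`L ⊇ ℚ` (e.g. `ℚ₂`, where odd primes `≡ ±1 (mod 9)`… or their squares have cube roots by Hensel):
consequence of Stewart–Yu's Lemma 3 for `q = 3` (there over `K = ℚ(ζ₆)` together with `ζ₆^{1/3}`),
via `Multicubic.finrank_adjoin_eq_three_pow_of_cube_eq` and `not_cube_prod_pow_primes_rat`.
[cite: StewartYu1991, Lemma 3 (p. 227), case q = 3, over ℚ] -/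
theorem finrank_adjoin_cbrt_primes_rat {L : Type*} [Field L] [Algebra ℚ L] {n : ℕ}
    (pr : Fin n → ℕ) (hpr : ∀ j, (pr j).Prime) (hinj : Function.Injective pr) (y : Fin n → L)
    (hy : ∀ j, y j ^ 3 = (pr j : L)) :
    Module.finrank ℚ ↥(IntermediateField.adjoin ℚ (Set.range y)) = 3 ^ n := by
  have h3 : (3 : L) ≠ 0 := by
    rw [show (3 : L) = algebraMap ℚ L 3 from (map_ofNat (algebraMap ℚ L) 3).symm]
    exact (_root_.map_ne_zero _).mpr three_ne_zero
  refine Multicubic.finrank_adjoin_eq_three_pow_of_cube_eq h3 (fun j => (pr j : ℚ)) y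
    (fun j => by rw [hy j, map_natCast]) fun k hk γ h => ?_
  exact not_cube_prod_pow_primes_rat pr hpr hinj k hk γ h.symm

/-- **`[ℚ((p₁²)^{1/3}, …, (pₙ²)^{1/3}) : ℚ] = 3ⁿ` for distinct primes** (cube roots in any `L ⊇ ℚ`;
the same fields as for `pⱼ^{1/3}`): the Kummer degree for the generators `αⱼ = qⱼ²` of the `2`-adic
`q = 3` descent over `ℚ`. [cite: StewartYu1991, Lemma 3 (p. 227), case q = 3, over ℚ] -/
theorem finrank_adjoin_cbrt_primes_sq_rat {L : Type*} [Field L] [Algebra ℚ L] {n : ℕ}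
    (pr : Fin n → ℕ) (hpr : ∀ j, (pr j).Prime) (hinj : Function.Injective pr) (y : Fin n → L)
    (hy : ∀ j, y j ^ 3 = (pr j : L) ^ 2) :
    Module.finrank ℚ ↥(IntermediateField.adjoin ℚ (Set.range y)) = 3 ^ n := by
  have h3 : (3 : L) ≠ 0 := by
    rw [show (3 : L) = algebraMap ℚ L 3 from (map_ofNat (algebraMap ℚ L) 3).symm]
    exact (_root_.map_ne_zero _).mpr three_ne_zero
  refine Multicubic.finrank_adjoin_eq_three_pow_of_cube_eq h3 (fun j => (pr j : ℚ) ^ 2) y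
    (fun j => by rw [hy j, map_pow, map_natCast]) fun k hk γ h => ?_
  exact not_cube_prod_pow_primes_sq_rat pr hpr hinj k hk γ h.symm

/-- **The `3ⁿ` cube-root monomials `∏ ((pⱼ²)^{1/3})^{λⱼ}`, `λ ∈ {0,1,2}ⁿ`, are linearly independent
over `ℚ`** (distinct primes; cube roots in any `L ⊇ ℚ`) — the separation of the `3ⁿ` descent classes
in the `2`-adic `q = 3` descent over `ℚ`. [cite: Yu1990, (2.110) (p. 59)]
[cite: StewartYu1991, Lemma 3 (p. 227), case q = 3, over ℚ] -/
theorem linearIndependent_prod_pow_cbrt_primes_sq_rat {L : Type*} [Field L] [Algebra ℚ L] {n : ℕ}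
    (pr : Fin n → ℕ) (hpr : ∀ j, (pr j).Prime) (hinj : Function.Injective pr) (y : Fin n → L)
    (hy : ∀ j, y j ^ 3 = (pr j : L) ^ 2) :
    LinearIndependent ℚ (fun l : Fin n → Fin 3 => ∏ j, y j ^ (l j : ℕ)) := by
  have h3 : (3 : L) ≠ 0 := by
    rw [show (3 : L) = algebraMap ℚ L 3 from (map_ofNat (algebraMap ℚ L) 3).symm]
    exact (_root_.map_ne_zero _).mpr three_ne_zero
  refine Multicubic.linearIndependent_prod_pow_of_cube_eq h3 (fun j => (pr j : ℚ) ^ 2) y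
    (fun j => by rw [hy j, map_pow, map_natCast]) fun k hk γ h => ?_
  exact not_cube_prod_pow_primes_sq_rat pr hpr hinj k hk γ h.symm

end CubeClassesRat

/-! ### Yu 1990, Lemma 1.8: `x^{r^k} − a` is irreducible when `a ∉ Eʳ` (`-1 ∈ E²` if `r = 2`) -/

section LemmaOneEight

universe u

/-- **Yu 1990, Lemma 1.8, the case `r = 2`.** Let `E` be a field with `-1 ∈ E²`. If `a ∈ E` is
not a square in `E`, then `x^{2^k} − a` is irreducible in `E[x]` for every `k` (induction on `k`:
over `E' = E(a^{1/2^k})` the generator is not a square, by taking norms `N_{E'/E}` and using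
`-1 ∈ E²` to absorb the sign). Mathlib has the odd-prime case
(`X_pow_sub_C_irreducible_of_prime_pow`, "TODO: generalize to `p = 2`").
[cite: Yu1990, Lemma 1.8 (pp. 27–28)] -/
theorem X_pow_two_pow_sub_C_irreducible {E : Type u} [Field E] (hE : IsSquare (-1 : E))
    {a : E} (ha : ∀ b : E, b ^ 2 ≠ a) (k : ℕ) : Irreducible (X ^ (2 ^ k) - C a) := by
  induction k generalizing E a with
  | zero => simpa using irreducible_X_sub_C a
  | succ k IH =>
    rw [pow_succ, mul_comm]
    apply X_pow_mul_sub_C_irreducible (IH hE ha)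
    intro E' _ _ x hx
    have hint : IsIntegral E x := not_not.mp fun h ↦ by
      simpa only [degree_zero, degree_X_pow_sub_C (pow_pos two_pos k),
        WithBot.natCast_ne_bot] using congr_arg degree (hx.symm.trans (dif_neg h))
    refine X_pow_sub_C_irreducible_of_prime Nat.prime_two fun b hb => ?_
    have hN := congrArg (Algebra.norm E) hb
    rw [map_pow, ← adjoin.powerBasis_gen hint,
      Algebra.PowerBasis.norm_gen_eq_coeff_zero_minpoly] at hN
    simp only [adjoin.powerBasis_dim, adjoin.powerBasis_gen, minpoly_gen, hx,
      coeff_sub, coeff_X_pow, coeff_C_zero, natDegree_X_pow_sub_C] at hN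
    rw [if_neg (pow_ne_zero k two_ne_zero).symm, zero_sub, mul_neg] at hN
    -- `hN : N(b)² = -((-1)^(2^k) a)`; with `i² = -1` this makes `a` a square in `E`
    obtain ⟨i, hi⟩ := hE
    rcases neg_one_pow_eq_or E (2 ^ k) with h1 | h1
    · rw [h1, one_mul] at hN
      exact ha (i * Algebra.norm E b) (by linear_combination (Algebra.norm E b ^ 2) * hi.symm - hN)
    · rw [h1, neg_mul, one_mul, neg_neg] at hN
      exact ha (Algebra.norm E b) hN

/-- **Yu 1990, Lemma 1.8** (from the Vahlen–Capelli theorem). Let `r` be a prime number, `k` a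
positive integer, and `E` a field; when `r = 2` suppose further that `-1 ∈ E²`. If `a ∈ E` and
`a ∉ Eʳ`, then the polynomial `x^{r^k} − a` is irreducible in `E[x]` (here for every `k ≥ 0`; the
odd case is Mathlib's `X_pow_sub_C_irreducible_of_prime_pow`). [cite: Yu1990, Lemma 1.8 (pp. 27–28)] -/
theorem yu1990_lemma_1_8 {E : Type u} [Field E] {r : ℕ} (hr : r.Prime)
    (h2 : r = 2 → IsSquare (-1 : E)) (k : ℕ) {a : E} (ha : ∀ b : E, b ^ r ≠ a) :
    Irreducible (X ^ (r ^ k) - C a) := by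
  by_cases hr2 : r = 2
  · subst hr2
    exact X_pow_two_pow_sub_C_irreducible (h2 rfl) ha k
  · exact X_pow_sub_C_irreducible_of_prime_pow hr hr2 k ha

end LemmaOneEight

/-! ### The norm form of a pure cubic step: the algebra of the third-point Liouville estimate -/

namespace Multicubic

section NormForm

variable {K L : Type*} [Field K] [Field L] [Algebra K L]

/-- **The norm form of a pure cubic step.** In any commutative ring, with `c = y³`:
`(u + v y + w y²) · ((u² − c v w) + (c w² − u v) y + (v² − u w) y²) = u³ + c v³ + c² w³ − 3c u v w`,
i.e. `N_{F(∛c)/F}(u + v ∛c + w ∛c²) = u³ + c v³ + c² w³ − 3c u v w` with an explicit cofactor in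
`F[∛c]` ("N(w) = w w′ w″ … a straightforward calculation shows that
`N(w) = x³ + ab²y³ + a²bz³ − 3abxyz`", the case `b = 1`). This is the identity behind the Liouville
step at the third points of a `q = 3` Kummer descent (the analogue of `x x̄ = u² − α v²` at `q = 2`).
[cite: Karpilovsky1988, §2.5, proof of Lemma 2.5.2, (12) (p. 63)] -/
theorem cubicNorm_eq_mul_cofactor {R : Type*} [CommRing R] (u v w y : R) :
    u ^ 3 + y ^ 3 * v ^ 3 + (y ^ 3) ^ 2 * w ^ 3 - 3 * y ^ 3 * u * v * w =
      (u + v * y + w * y ^ 2) *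
        ((u ^ 2 - y ^ 3 * v * w) + (y ^ 3 * w ^ 2 - u * v) * y + (v ^ 2 - u * w) * y ^ 2) := by
  ring

/-- **`1, y, y²` are linearly independent over `F`** when `y³ ∈ F` is not a cube in `F`
(`[F(y) : F] = 3`, Vahlen–Capelli for `n = 3`): `u + v y + w y² = 0` with `u, v, w ∈ F` forces
`u = v = w = 0`. [cite: Yu1990, Vahlen–Capelli Theorem (p. 28)] -/
theorem eq_zero_of_add_mul_add_mul_sq_eq_zero (F : IntermediateField K L) {y : L} (hy3 : y ^ 3 ∈ F)
    (hnc : ∀ z ∈ F, z ^ 3 ≠ y ^ 3) {u v w : L} (hu : u ∈ F) (hv : v ∈ F) (hw : w ∈ F)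
    (h : u + v * y + w * y ^ 2 = 0) : u = 0 ∧ v = 0 ∧ w = 0 :=
  eq_zero_of_repr_eq_zero F hy3 hnc hu hv hw h

/-- **The norm form does not vanish:** if `y³ ∈ F` is not the cube of an element of `F` and
`u, v, w ∈ F` are not all zero, then `u³ + y³ v³ + y⁶ w³ − 3 y³ u v w ≠ 0` (no hypothesis on the
characteristic and no cube root of unity needed: if the cofactor vanished, comparing coefficients
gives `u² = y³ v w`, `y³ w² = u v`, `v² = u w`, whence `u = v = w = 0` or `(u/v)³ = y³` with
`u/v ∈ F`). With `F = K(∛α₁, …, ∛α_k)` and `y = ∛α_{k+1}` this is the non-vanishing of the norm to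
the previous floor of a non-zero value at a third point, the input of the Liouville estimate of the
`q = 3` descent. [cite: Karpilovsky1988, §2.5, (12) (p. 63)]
[cite: Yu1990, Lemma 1.9 (p. 28), p = 3] -/
theorem cubicNorm_ne_zero (F : IntermediateField K L) {y : L} (hy3 : y ^ 3 ∈ F)
    (hnc : ∀ z ∈ F, z ^ 3 ≠ y ^ 3) {u v w : L} (hu : u ∈ F) (hv : v ∈ F) (hw : w ∈ F)
    (h0 : ¬ (u = 0 ∧ v = 0 ∧ w = 0)) :
    u ^ 3 + y ^ 3 * v ^ 3 + (y ^ 3) ^ 2 * w ^ 3 - 3 * y ^ 3 * u * v * w ≠ 0 := by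
  intro hN
  have hx : u + v * y + w * y ^ 2 ≠ 0 := fun h =>
    h0 (eq_zero_of_repr_eq_zero F hy3 hnc hu hv hw h)
  rw [cubicNorm_eq_mul_cofactor] at hN
  have hcof : (u ^ 2 - y ^ 3 * v * w) + (y ^ 3 * w ^ 2 - u * v) * y + (v ^ 2 - u * w) * y ^ 2 = 0 :=
    (mul_eq_zero.mp hN).resolve_left hx
  obtain ⟨h1, h2, h3⟩ := eq_zero_of_repr_eq_zero F hy3 hnc
    (sub_mem (pow_mem hu 2) (mul_mem (mul_mem hy3 hv) hw))
    (sub_mem (mul_mem hy3 (pow_mem hw 2)) (mul_mem hu hv))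
    (sub_mem (pow_mem hv 2) (mul_mem hu hw)) hcof
  have hy0 : y ^ 3 ≠ 0 := by
    intro h
    exact hnc 0 (zero_mem F) (by rw [h]; norm_num)
  by_cases hu0 : u = 0
  · have hv0 : v = 0 := by
      have : v ^ 2 = 0 := by rw [hu0, zero_mul, sub_zero] at h3; exact h3
      exact pow_eq_zero_iff two_ne_zero |>.mp this
    have hw0 : w = 0 := by
      have : y ^ 3 * w ^ 2 = 0 := by rw [hu0, zero_mul, sub_zero] at h2; exact h2
      rcases mul_eq_zero.mp this with h | h
      · exact absurd h hy0
      · exact pow_eq_zero_iff two_ne_zero |>.mp h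
    exact h0 ⟨hu0, hv0, hw0⟩
  · have hv0 : v ≠ 0 := by
      intro hv0
      have huw : u * w = 0 := by
        have : v ^ 2 - u * w = 0 := h3
        rw [hv0] at this; linear_combination -this
      have hw0 : w = 0 := (mul_eq_zero.mp huw).resolve_left hu0
      apply hu0
      have : u ^ 2 = 0 := by
        have h1' : u ^ 2 - y ^ 3 * v * w = 0 := h1
        rw [hw0, mul_zero, sub_zero] at h1'; exact h1'
      exact pow_eq_zero_iff two_ne_zero |>.mp this
    have hcube : u ^ 3 = y ^ 3 * v ^ 3 := by
      linear_combination u * h1 - y ^ 3 * v * h3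
    refine hnc (u / v) (div_mem hu hv) ?_
    rw [div_pow, div_eq_iff (pow_ne_zero 3 hv0)]
    linear_combination hcube

/-- **The top generator is not a cube below it.** If `y₀, …, yₙ ∈ L` satisfy `yⱼ³ = αⱼ ∈ K`
(`char ≠ 3`) and no monomial `∏ αⱼ^{kⱼ}` with some `kⱼ ≢ 0 (mod 3)` is a cube in `K`, then `αₙ = yₙ³`
is not the cube of an element of `K(y₀, …, y_{n−1})` — the hypothesis `hnc` of `cubicNorm_ne_zero`
and `cube_descent` at the top floor of the tower (from the `m`-fold Baker–Stark descent
`finrank_adjoin_image_cbrt_and_cube`). [cite: Yu1990, Lemma 1.9 (p. 28), iterated, p = 3] -/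
theorem not_cube_mem_adjoin_init_of_cube_eq (h3 : (3 : L) ≠ 0) {n : ℕ} (α : Fin (n + 1) → K)
    (y : Fin (n + 1) → L) (hy : ∀ j, y j ^ 3 = algebraMap K L (α j))
    (hind : ∀ k : Fin (n + 1) → ℕ, (∃ j, ¬ 3 ∣ k j) → ∀ γ : K, ∏ j, α j ^ k j ≠ γ ^ 3) :
    ∀ z ∈ IntermediateField.adjoin K (Set.range (Fin.init y)), z ^ 3 ≠ y (Fin.last n) ^ 3 := by
  classical
  set c : ℕ → K := fun i => if h : i < n + 1 then α ⟨i, h⟩ else 0 with hc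
  set y' : ℕ → L := fun i => if h : i < n + 1 then y ⟨i, h⟩ else 0 with hy'
  have hyc : ∀ i, algebraMap K L (c i) = y' i ^ 3 := by
    intro i
    by_cases h : i < n + 1
    · simp only [hc, hy', dif_pos h]; exact (hy _).symm
    · simp only [hc, hy', dif_neg h, map_zero]; norm_num
  have hrange : Set.range (Fin.init y) = y' '' {i | i < n} := by
    ext z
    simp only [Set.mem_range, Set.mem_image, Set.mem_setOf_eq]
    constructor
    · rintro ⟨j, rfl⟩
      refine ⟨j, j.2, ?_⟩
      have hj : (j : ℕ) < n + 1 := by omega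
      simp only [hy', dif_pos hj, Fin.init]
      rfl
    · rintro ⟨i, hi, rfl⟩
      refine ⟨⟨i, hi⟩, ?_⟩
      have hi' : i < n + 1 := by omega
      simp only [hy', dif_pos hi', Fin.init]
      rfl
  have hind' : ∀ k : ℕ → ℕ, (∃ i < n + 1, ¬ 3 ∣ k i) →
      ∀ γ : K, ∏ i ∈ Finset.range (n + 1), c i ^ k i ≠ γ ^ 3 := by
    rintro k ⟨i, hi, hki⟩ γ hγ
    refine hind (fun j => k j) ⟨⟨i, hi⟩, hki⟩ γ ?_
    rw [← hγ, ← Fin.prod_univ_eq_prod_range (fun i => c i ^ k i) (n + 1)]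
    refine Finset.prod_congr rfl fun j _ => ?_
    have hj : (j : ℕ) < n + 1 := j.2
    simp only [hc, dif_pos hj, Fin.eta]
  intro z hz hzc
  rw [hrange] at hz
  have hlast : y (Fin.last n) = y' n := by
    simp only [hy', dif_pos (Nat.lt_succ_self n)]; rfl
  obtain ⟨k, γ, hkγ⟩ := (finrank_adjoin_image_cbrt_and_cube h3 y' c hyc (n + 1) hind' n
    (Nat.le_succ n)).2 (c n) ⟨z, hz, by rw [hyc n, ← hlast, hzc]⟩
  let k' : ℕ → ℕ := fun i => if i = n then 1 else k i
  refine hind' k' ⟨n, Nat.lt_succ_self n, by simp [k']⟩ γ ?_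
  rw [Finset.prod_range_succ]
  have hkn : k' n = 1 := by simp [k']
  rw [hkn, pow_one, ← hkγ, mul_comm]
  congr 1
  refine Finset.prod_congr rfl fun i hi => ?_
  have h1 : i ≠ n := (Finset.mem_range.mp hi).ne
  simp [k', h1]

/-- **Third-point Liouville algebra, packaged:** under the cube-Kummer hypothesis on
`α₀, …, αₙ ∈ K` (`char ≠ 3`), for `u, v, w ∈ K(y₀, …, y_{n−1})` not all zero the norm form
`u³ + αₙ v³ + αₙ² w³ − 3αₙ u v w` is non-zero. [cite: Yu1990, Lemma 1.9 (p. 28), p = 3]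
[cite: Karpilovsky1988, §2.5, (12) (p. 63)] -/
theorem cubicNorm_ne_zero_of_cube_eq (h3 : (3 : L) ≠ 0) {n : ℕ} (α : Fin (n + 1) → K)
    (y : Fin (n + 1) → L) (hy : ∀ j, y j ^ 3 = algebraMap K L (α j))
    (hind : ∀ k : Fin (n + 1) → ℕ, (∃ j, ¬ 3 ∣ k j) → ∀ γ : K, ∏ j, α j ^ k j ≠ γ ^ 3)
    {u v w : L} (hu : u ∈ IntermediateField.adjoin K (Set.range (Fin.init y)))
    (hv : v ∈ IntermediateField.adjoin K (Set.range (Fin.init y)))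
    (hw : w ∈ IntermediateField.adjoin K (Set.range (Fin.init y)))
    (h0 : ¬ (u = 0 ∧ v = 0 ∧ w = 0)) :
    u ^ 3 + y (Fin.last n) ^ 3 * v ^ 3 + (y (Fin.last n) ^ 3) ^ 2 * w ^ 3 -
      3 * y (Fin.last n) ^ 3 * u * v * w ≠ 0 := by
  have hy3 : y (Fin.last n) ^ 3 ∈ IntermediateField.adjoin K (Set.range (Fin.init y)) := by
    rw [hy]; exact IntermediateField.algebraMap_mem _ _
  exact cubicNorm_ne_zero _ hy3 (not_cube_mem_adjoin_init_of_cube_eq h3 α y hy hind) hu hv hw h0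

end NormForm

end Multicubic

/-! #### The case of squares of distinct primes over `ℚ` (the `2`-adic `q = 3` descent) -/

section NormFormRat

/-- For distinct primes `p₀, …, pₙ` and `yⱼ ∈ L ⊇ ℚ` with `yⱼ³ = pⱼ²`: `pₙ²` is not the cube of an
element of `ℚ(y₀, …, y_{n−1})`. [cite: Yu1990, Lemma 1.9 (p. 28), p = 3] -/
theorem not_cube_mem_adjoin_init_cbrt_primes_sq_rat {L : Type*} [Field L] [Algebra ℚ L] {n : ℕ}
    (pr : Fin (n + 1) → ℕ) (hpr : ∀ j, (pr j).Prime) (hinj : Function.Injective pr)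
    (y : Fin (n + 1) → L) (hy : ∀ j, y j ^ 3 = ((pr j : L) ^ 2)) :
    ∀ z ∈ IntermediateField.adjoin ℚ (Set.range (Fin.init y)), z ^ 3 ≠ y (Fin.last n) ^ 3 := by
  have h3 : (3 : L) ≠ 0 := by
    rw [show (3 : L) = algebraMap ℚ L 3 from (map_ofNat (algebraMap ℚ L) 3).symm]
    exact (_root_.map_ne_zero _).mpr three_ne_zero
  refine Multicubic.not_cube_mem_adjoin_init_of_cube_eq h3 (fun j => ((pr j : ℚ) ^ 2)) y
    (fun j => by rw [hy j, map_pow, map_natCast]) ?_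
  intro k hk γ hγ
  exact not_cube_prod_pow_primes_sq_rat pr hpr hinj k hk γ hγ.symm

/-- **Third-point Liouville algebra for the generators `pⱼ²`:** for distinct primes `p₀, …, pₙ`,
cube roots `yⱼ³ = pⱼ²` in any `L ⊇ ℚ` (e.g. `L = ℚ₂`, where they exist by Hensel), and
`u, v, w ∈ ℚ(y₀, …, y_{n−1})` not all zero:
`u³ + pₙ² v³ + pₙ⁴ w³ − 3 pₙ² u v w ≠ 0`. [cite: Yu1990, Lemma 1.9 (p. 28), p = 3]
[cite: Karpilovsky1988, §2.5, (12) (p. 63)] -/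
theorem cubicNorm_ne_zero_cbrt_primes_sq_rat {L : Type*} [Field L] [Algebra ℚ L] {n : ℕ}
    (pr : Fin (n + 1) → ℕ) (hpr : ∀ j, (pr j).Prime) (hinj : Function.Injective pr)
    (y : Fin (n + 1) → L) (hy : ∀ j, y j ^ 3 = ((pr j : L) ^ 2))
    {u v w : L} (hu : u ∈ IntermediateField.adjoin ℚ (Set.range (Fin.init y)))
    (hv : v ∈ IntermediateField.adjoin ℚ (Set.range (Fin.init y)))
    (hw : w ∈ IntermediateField.adjoin ℚ (Set.range (Fin.init y)))
    (h0 : ¬ (u = 0 ∧ v = 0 ∧ w = 0)) :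
    u ^ 3 + ((pr (Fin.last n) : L) ^ 2) * v ^ 3 + ((pr (Fin.last n) : L) ^ 2) ^ 2 * w ^ 3 -
      3 * ((pr (Fin.last n) : L) ^ 2) * u * v * w ≠ 0 := by
  have hy3 : y (Fin.last n) ^ 3 ∈ IntermediateField.adjoin ℚ (Set.range (Fin.init y)) := by
    rw [hy]
    exact pow_mem (by exact_mod_cast IntermediateField.natCast_mem _ (pr (Fin.last n))) 2
  have := Multicubic.cubicNorm_ne_zero _ hy3
    (not_cube_mem_adjoin_init_cbrt_primes_sq_rat pr hpr hinj y hy) hu hv hw h0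
  rwa [hy] at this

end NormFormRat

end Literature.Barriers.ABC

end
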